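import Literature.AlgebraicGeometry.HodgeTheory.WeilClassesFieldOrthogonalCornersParity
import Literature.AlgebraicGeometry.HodgeTheory.WeilClassesFieldQuaternionMatricesDecomposable
import Literature.AlgebraicGeometry.HodgeTheory.WeilClassesFieldQuaternionEndLevel
import HarnessLib

/-!
# Moonen–Zarhin's Criterion (2), TYPE 3 ON POWERS `A^{n+1}`: `F ⊆ M_{n+1}(D)` for a DEFINITE quaternion algebra
# `D = ℚ(ψ)⟨α, β⟩` (Rosati-SKEW anticommuting `α, β` over the real-multiplication centre `ℚ(ψ)`) has decomposable,
# hence algebraic, Weil classes as soon as every per-place exponent is EVEN (Moonen–Zarhin 1998 §1, Criterion (2),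
# «Y of Type 3, m ≥ 2», the decomposable alternative, on the carrier)

Layer `Literature/AlgebraicGeometry/HodgeTheory`; THEOREMS ONLY — no definition, no named fact, no `sorry` (D-0026, net
debt 0).  The INSTANCE announced by the seat's `WeilClassesFieldOrthogonalCornersParity` (g23-#1: orthogonal corners,
identified Morita exponents, «even exponents ⟹ decomposable»); the type-3 twin of the seat's type-2 file
`WeilClassesFieldQuaternionOverRealFieldMatricesDecomposable` (same units, Rosati sign flipped: the corners become
isotropic and the group factor becomes `O_{2k}`).

## The print

B. J. J. Moonen, Yu. G. Zarhin, *Weil classes on abelian varieties*, J. reine angew. Math. **496** (1998) 83–92 =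
arXiv:alg-geom/9612017 [MoonenZarhin1998WeilClasses] (held text `paper:arxiv-alg-geom_9612017`), §1, VERBATIM.
Criterion (2) (chunk p0003 L46–L60): «… either all classes in `W_F` are decomposable, or all non-zero classes in `W_F` are
exceptional; this last possibility occurs precisely in the following cases: … `Y` is of Type 3, `m ≥ 2` and the integer
`2m · [E:ℚ]/[F:ℚ]` is odd, …».  Table 1 / «`B = M_m(D)`, hence `F ⊆ B`» (chunk p0003 L92–L94); Table 2: for type 3,
`Δ_ℂ^{(τ)} = M_m(D) ⊗_{E,τ} ℂ ≅ M_{2m}(ℂ)`, `V^{(τ)} = Stand_{2m} ⊗ W^{(τ)}`, «`G_div^{(τ)} ≅ O_{2k}`» (chunk p0002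
L104–L118, p0003 L100–L102); Lemma (2): «for `X` of type 3 and `m ≥ 2`, the group `π₀(G_div(X))` has (geometrically)
order `2^{e₀}`»; proof (chunk p0003 L95–L111): «the connected component of the identity `G_div⁰` acts trivially on `W_F`.
Next consider an embedding `τ : E → ℂ`, and an element `g ∈ G_div^{(τ)}(ℂ)` which is not in the connected component …
`Nrd_ℂ(g) = det_ℂ(g) = -1` … `g` acts on `W_F ⊗ ℂ` as multiplication by `(-1)^{2m/[F:E]}`».
H. Lange, Ch. Birkenhake, *Complex Abelian Varieties* [LangeBirkenhake1992], Ch. 5 §5 (held PDF p. 138): for `F = End_ℚ(X)`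
a «totally definite quaternion algebra» over the totally real `K` (type III), `End_ℚ(X) ⊗ ℝ ≃ ∏ ℍ` «such that the
anti-involution translates to quaternion conjugation on the factors» — the Rosati involution is `x ↦ x̄`, so pure
quaternions `α, β` are Rosati-SKEW, `α² = -Nrd(α) ∈ K` totally negative.

## What is proved (on the carrier `H¹(A^{n+1}(ℂ); ℂ)`, `D_X = Σ πᵢ^* h`)

§0 (private) polynomial / spectral calculus and the normaliser `sq_normaliser` (as in the seat's type-2 file).
§1 (`Literature.LinearAlgebra`) **`two_mul_finrank_range_mul_eq_finrank_range`** — idempotents `p + q = 1`, `pq = qp = 0`,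
an involution `t` (`t² = 1`) with `t p t = q`, and `e` commuting with `p, t`: `2 · dim(e p V) = dim(e V)` (the two
corners of `M₂(ℂ)` exchanged by `t` have the same dimension); private `2 × 2` calculus of a skew pair.
§2 slot lemmas on `X = A^{n+1}`: `pullbackOne_biproductMap_const_neg_eq` (`(⊕(-f))^* = -(⊕f)^*`),
**`polarizationPairingOne_biproductMap_const_of_skew`** (a Rosati-skew `g` has Rosati-skew diagonal `⊕g` for `D_X`),
**`finrank_range_π_comp_ι_inf_eigenspace_biproductMap_eq`** (`dim(e_{cc}V ∩ ker((⊕ψ)^* - z)) = dim ker(ψ^* - z)`).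
§3 `range_aeval_lagrange_basis_mul_eq_of_comm` (`P_z f V = f V ∩ ker(T - z)` for `f` commuting with `T`).
§4 **`weilClassesField_biproduct_le_divisorClassesSpan_of_mem_adjoin_definiteQuaternionOver_diagonal_of_dvd`** — for
`A` with `h ∈ B¹ ⊗ ℂ`, `h^{dim} ≠ 0`, `Q_h` non-degenerate; `ψ^*` `Q_h`-symmetric with `Q(ψ) = 0` (`Q` monic irreducible
over `ℚ`); `α^*, β^*` `Q_h`-SKEW, commuting with `ψ^*`, anticommuting, `α^{*2} = a(ψ^*)`, `β^{*2} = b(ψ^*)` with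
`a(z) b(z) ≠ 0` at every complex root `z` of `Q`; `φ ∈ End(A^{n+1})` with `φ^* ∈ ℂ⟨(⊕ψ)^*, (⊕α)^*, (⊕β)^*, (πₐ ≫ ι_b)^*⟩`
(`F ⊆ M_{n+1}(ℚ(ψ)⟨α, β⟩)`), `P(φ) = 0` (`P` monic irreducible, `deg P · 2m = 2(n+1) dim A`); IF
`dim ker(ψ^* - z) ∣ dim(V_ρ ∩ ker((⊕ψ)^* - z))` for every root `ρ` of `P` and every root `z` of `Q`, THEN
`W_F ⊗ ℂ ≤ 𝒟ᵐ ⊗ ℂ`; `…_le_hodgeClassSpan_…`, **`…_le_algebraicClasses_…`**, `mem_algebraicClasses_of_mem_weilClassesField_…`.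
§5 centre `ℚ`: **`weilClassesField_biproduct_le_divisorClassesSpan_of_mem_adjoin_definiteQuaternion_diagonal_of_dvd`** —
`α^{*2} = a`, `β^{*2} = b` non-zero scalars, `φ^* ∈ ℂ⟨(⊕α)^*, (⊕β)^*, (πₐ ≫ ι_b)^*⟩`, and `dim A ∣ m` (equivalently
`[F:ℚ] ∣ n + 1`) ⟹ `W_F ⊗ ℂ ≤ 𝒟ᵐ ⊗ ℂ`; `…_le_algebraicClasses_…`.

Proof of §4: `T = (⊕ψ)^*` (Lagrange projectors `P_z` at the roots of `Q`), `S = (⊕α)^* · a(T)^{-1/2}`,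
`T′ = (⊕β)^* · b(T)^{-1/2}` (§0 `sq_normaliser`; `S² = T′² = 1`, `S T′ = -T′ S`, both `Q_{D_X}`-skew, §2);
`p′ = ½(1 + S)`, `q′ = ½(1 - S) = T′ p′ T′`, units `x′ = (p′, T′p′)`, `y′ = (p′, p′T′)` (`y′ᵢ x′ⱼ = δᵢⱼ p′`, `Σ x′ᵢ y′ᵢ = 1`),
`p′V` ISOTROPIC (`p′† = q′`, `q′ p′ = 0`) with partner `q′V = T′(p′V)`, so `Q_{D_X}(·, T′ ·)` is symmetric and
non-degenerate on `p′V`; the combined datum `x_{(i,c)} = e_{i0} x′_c`, `y_{(i,c)} = y′_c e_{0i}`, `p = e_{00} p′` over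
`Fin (n+1) × Fin 2` inside the pull-back algebra, commuting with `T`, with corner operator `T′` (non-degeneracy descends to
`pV = e_{00} p′V` through `Σₐ e_{aa} = 1`, `e_{aa}† = e_{aa}`); the exponent: `pV ∩ ker(T - z) = (P_z e_{00}) p′ V` (§3) and
`2 dim((P_z e_{00}) p′ V) = dim(P_z e_{00} V) = dim(e_{00}V ∩ ker(T - z)) = dim ker(ψ^* - z)` (§1 with `e = P_z e_{00}`,
§2), so the hypothesis reads `dim(V_ρ ∩ ker(T - z)) = 2j · dim(pV ∩ ker(T - z))`; then the seat's
`weilClassesField_le_divisorClassesSpan_of_moritaData_of_cornerForm_of_symmetric_of_even` (g23-#1 §3).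

## Relation to the print; scope (honest column)

* The print's row «`Y` of Type 3, `m ≥ 2`, `2m[E:ℚ]/[F:ℚ]` even ⟹ decomposable» is rendered with the parity read
  PLACE BY PLACE: `l_z(ρ) = dim(V_ρ ∩ V_X^{(z)}) / ½ dim V_A^{(z)}` even for every root `z` of `Q` (place of
  `E = ℚ(ψ)`) and every root `ρ` of `P`; `Σ_z l_z(ρ) = 2m′[E:ℚ]/[F:ℚ]` (`m′ = n + 1`) is the print's integer, and the two
  conditions coincide when `[E:ℚ] = 1` (§5: `[F:ℚ] ∣ n + 1`) or `E ⊆ F` (see the honest column of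
  `WeilClassesFieldOrthogonalCornersParity` for the general case, where per-place evenness is the stronger condition and
  the one the determinant computation yields).
* DECOMPOSABLE DIRECTION ONLY; «odd ⟹ all non-zero classes exceptional» needs reflections in `S(X)(D_X)(ℂ)` and the
  hypothesis that `M_{n+1}(D) ⊗ ℂ` is the whole pull-back algebra (`End⁰(A) = D`): not here.
* Any `A` of positive dimension (no simplicity, no `End⁰(A) = D`; for `A` simple of type 3 with `End⁰(A) = D` and
  `X ∼ A^{n+1}` this is the print's row up to isogeny — transport by the seat's `WeilClassesFieldIsogenyTransportOfStructure`);
  `a, b` may have complex coefficients; the existence of a Rosati-skew anticommuting presentation `α, β` of a given definite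
  `D` (two orthogonal pure quaternions) is assumed, not derived; `F` is any subfield of `M_{n+1}(D)` generated by one
  `φ` with `φ^*` in the displayed algebra.  No algebraic groups, connectedness or `π₀`.

## References

* [MoonenZarhin1998WeilClasses] B. J. J. Moonen, Yu. G. Zarhin, Weil classes on abelian varieties, J. reine angew.
  Math. 496 (1998) 83–92; arXiv:alg-geom/9612017: §1 Criterion (2) and its proof, type 3 (chunk p0003 L46–L60,
  L92–L111; p0004 L1–L27), Lemma (2), Tables 1–2 (chunk p0002 L60–L118, p0003 L1–L4).
* [Milne1999LefschetzClasses] J. S. Milne, Lefschetz classes on abelian varieties, Duke Math. J. 96 (1999), §1 p. 643,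
  Thm. 3.2, Cor. 4.5.
* [LangeBirkenhake1992] H. Lange, Ch. Birkenhake, Complex Abelian Varieties (1992), §1.1, §5.1, §5.3, Ch. 5 §5 (the table
  of endomorphism algebras, held PDF p. 138).
* [McconnellRobson2001] J. C. McConnell, J. C. Robson, Noncommutative Noetherian Rings, GSM 30 (AMS 2001), 3.5.5–3.5.7.
* [HornJohnson2013] R. A. Horn, C. R. Johnson, Matrix Analysis, 2nd ed. (CUP 2013), §0.4, §1.1, §1.3.
* [HatcherAT2002] A. Hatcher, Algebraic Topology (CUP 2002), §3.2 Thm. 3.16.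
* [vanGeemen1994HodgeAV] B. van Geemen, LNM 1594 (1994), §2.4.
* [VoisinHodgeI2002] C. Voisin, Hodge Theory and Complex Algebraic Geometry I (CUP 2002), Thm. 11.30.

## Provenance

Lane `lit-hodgefound` (Track 2, Layer A), prover seat `lit-hodgefound-p21` (generation 23), row g23-#2 (the instance
of g23-#1 `WeilClassesFieldOrthogonalCornersParity`).
-/

noncomputable section

open CategoryTheory CategoryTheory.Limits
open Literature.AlgebraicTopology.SingularHomology
open Literature.AlgebraicGeometry.Motives
open Literature.AlgebraicGeometry.VanGeemen1994 (hodgeClassSpan pullbackOne)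
open Literature.AlgebraicGeometry.Milne1999
open Literature.AlgebraicGeometry.Pohlmann1968 (sum_map_π_map_ι map_biproductMap_map_π map_ι_map_π_self)
open Literature.Geometry.Kaehler (lefschetzPow)
open Literature.Barriers.HodgeConjecture (divisorClassesSpan)
open Literature.LinearAlgebra
open Polynomial

/-! ### §1 Linear algebra: the two corners exchanged by `t` have the same dimension -/

namespace Literature.LinearAlgebra

/-- **`2 · dim(e p V) = dim(e V)` when an involution exchanges the complementary idempotents `p`, `q`.** For idempotents
`p + q = 1`, `q p = p q = 0`, an operator `t` with `t² = 1` and `t p t = q`, and an operator `e` commuting with `p` and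
`t`: `e V = e p V ⊕ e q V` with `e q = t (e p) t`, so `dim(e q V) = dim(e p V)` and `2 dim(e p V) = dim(e V)`.  For the
`M₂(ℂ)` of a split quaternion algebra (`p = ½(1 + s)`, `q = ½(1 - s)`): the two corners have equal dimension — «`Stand`
has dimension `2k`, `V^{(τ)} = ℂ² ⊗ Stand`». [folklore] [cite: McconnellRobson2001, 3.5.5–3.5.7]
[cite: HornJohnson2013, §0.4 (rank), §1.3 (similarity)] -/
theorem two_mul_finrank_range_mul_eq_finrank_range {K V : Type*} [Field K] [AddCommGroup V] [Module K V]
    [FiniteDimensional K V] {e p q t : Module.End K V} (hpq : p + q = 1) (hqp : q * p = 0) (hpq0 : p * q = 0)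
    (htt : t * t = 1) (htpt : t * p * t = q) (hep : e * p = p * e) (het : e * t = t * e) :
    2 * Module.finrank K (LinearMap.range (e * p)) = Module.finrank K (LinearMap.range e) := by
  have hpp : p * p = p := by
    have h := congrArg (· * p) hpq
    simp only [add_mul, one_mul, hqp, add_zero] at h
    exact h
  have heq : e * q = q * e := by
    have hq : q = 1 - p := by rw [← hpq, add_sub_cancel_left]
    rw [hq, mul_sub, sub_mul, mul_one, one_mul, hep]
  -- `e q = t (e p) t`
  have hconj : e * q = t * (e * p) * t := by
    rw [← mul_assoc, ← het, mul_assoc, mul_assoc, ← htpt, mul_assoc]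
  -- `dim(e q V) = dim(e p V)`
  have htinj : Function.Injective t := fun a b hab ↦ by
    have h := congrArg t hab
    rwa [← Module.End.mul_apply, ← Module.End.mul_apply, htt, Module.End.one_apply, Module.End.one_apply] at h
  have htsurj : LinearMap.range t = ⊤ := LinearMap.range_eq_top.2 fun v ↦ ⟨t v, by
    rw [← Module.End.mul_apply, htt, Module.End.one_apply]⟩
  have hdimq : Module.finrank K (LinearMap.range (e * q)) = Module.finrank K (LinearMap.range (e * p)) := by
    rw [hconj, Module.End.mul_eq_comp, Module.End.mul_eq_comp, LinearMap.range_comp_of_range_eq_top _ htsurj,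
      LinearMap.range_comp]
    exact (LinearEquiv.finrank_eq (Submodule.equivMapOfInjective t htinj _)).symm
  -- `e V = e p V ⊕ e q V`
  have hsup : LinearMap.range (e * p) ⊔ LinearMap.range (e * q) = LinearMap.range e := by
    refine le_antisymm (sup_le ?_ ?_) ?_
    · rintro _ ⟨v, rfl⟩
      exact ⟨p v, by rw [Module.End.mul_apply, ← Module.End.mul_apply e p, hep, Module.End.mul_apply]⟩
    · rintro _ ⟨v, rfl⟩
      exact ⟨q v, by rw [Module.End.mul_apply, ← Module.End.mul_apply e q, heq, Module.End.mul_apply]⟩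
    · rintro _ ⟨v, rfl⟩
      have hv : e v = (e * p) v + (e * q) v := by
        rw [← LinearMap.add_apply, ← mul_add, hpq, mul_one]
      rw [hv]
      exact Submodule.add_mem _ (Submodule.mem_sup_left ⟨v, rfl⟩) (Submodule.mem_sup_right ⟨v, rfl⟩)
  have hinf : LinearMap.range (e * p) ⊓ LinearMap.range (e * q) = ⊥ := by
    rw [Submodule.eq_bot_iff]
    rintro v ⟨⟨a, rfl⟩, ⟨b, hb⟩⟩
    have h1 : p ((e * p) a) = (e * p) a := by
      rw [Module.End.mul_apply, ← Module.End.mul_apply p e, ← hep, Module.End.mul_apply, ← Module.End.mul_apply p p, hpp]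
    have h2 : p ((e * q) b) = 0 := by
      rw [Module.End.mul_apply, ← Module.End.mul_apply p e, ← hep, Module.End.mul_apply, ← Module.End.mul_apply p q, hpq0,
        LinearMap.zero_apply, map_zero]
    rw [← h1, ← hb, h2]
  have hdim := Submodule.finrank_sup_add_finrank_inf_eq (LinearMap.range (e * p)) (LinearMap.range (e * q))
  rw [hsup, hinf, finrank_bot, add_zero, hdimq] at hdim
  omega

section SkewPairCalc

variable {R : Type*} [Ring R] [Algebra ℂ R] {s t : R}

/-- `p² = p` for `p = ½(1 + s)`, `s² = 1`. [folklore] -/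
private theorem sp_half_one_add_mul_self (hs : s * s = 1) :
    ((2:ℂ)⁻¹ • (1 + s)) * ((2:ℂ)⁻¹ • (1 + s)) = (2:ℂ)⁻¹ • (1 + s) := by
  rw [smul_mul_assoc, mul_smul_comm, smul_smul, mul_add, add_mul, add_mul, one_mul, mul_one, one_mul, hs]
  module

/-- `p t p = 0`. [folklore] -/
private theorem sp_half_one_add_mul_mul_half_one_add (hs : s * s = 1) (hst : s * t = -(t * s)) :
    ((2:ℂ)⁻¹ • (1 + s)) * t * ((2:ℂ)⁻¹ • (1 + s)) = 0 := by
  have hsts : s * t * s = -t := by rw [hst, neg_mul, mul_assoc, hs, mul_one]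
  rw [smul_mul_assoc, smul_mul_assoc, mul_smul_comm, smul_smul, add_mul, add_mul, one_mul, mul_add,
    mul_add, mul_one, mul_one, hsts, hst]
  module

/-- `t p t = q = ½(1 - s)`. [folklore] -/
private theorem sp_mul_half_one_add_mul (ht : t * t = 1) (hst : s * t = -(t * s)) :
    t * ((2:ℂ)⁻¹ • (1 + s)) * t = (2:ℂ)⁻¹ • (1 - s) := by
  have htst : t * s * t = -s := by rw [mul_assoc, hst, mul_neg, ← mul_assoc, ht, one_mul]
  rw [mul_smul_comm, smul_mul_assoc, mul_add, add_mul, mul_one, ht, htst]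
  module

/-- `p + q = 1`. [folklore] -/
private theorem sp_half_one_add_add_half_one_sub : (2:ℂ)⁻¹ • (1 + s) + (2:ℂ)⁻¹ • (1 - s) = 1 := by module

/-- `p - q = s`. [folklore] -/
private theorem sp_half_one_add_sub_half_one_sub : (2:ℂ)⁻¹ • (1 + s) - (2:ℂ)⁻¹ • (1 - s) = s := by module

/-- `t q = p t`. [folklore] -/
private theorem sp_mul_half_one_sub_eq (hst : s * t = -(t * s)) :
    t * ((2:ℂ)⁻¹ • (1 - s)) = ((2:ℂ)⁻¹ • (1 + s)) * t := by
  rw [smul_mul_assoc, mul_smul_comm, add_mul, one_mul, hst, mul_sub, mul_one]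
  module

/-- `t = t p + p t`. [folklore] -/
private theorem sp_eq_mul_half_one_add_add (hst : s * t = -(t * s)) :
    t * ((2:ℂ)⁻¹ • (1 + s)) + ((2:ℂ)⁻¹ • (1 + s)) * t = t := by
  rw [← sp_mul_half_one_sub_eq hst, ← mul_add, sp_half_one_add_add_half_one_sub, mul_one]

/-- An operator commuting with `s` commutes with `½(1 ± s)`. [folklore] -/
private theorem sp_comm_half (L : R) (hLs : L * s = s * L) (ε : R) (hε : ε = s ∨ ε = -s) :
    L * ((2:ℂ)⁻¹ • (1 + ε)) = ((2:ℂ)⁻¹ • (1 + ε)) * L := by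
  rcases hε with rfl | rfl
  · rw [mul_smul_comm, smul_mul_assoc, mul_add, add_mul, mul_one, one_mul, hLs]
  · rw [mul_smul_comm, smul_mul_assoc, mul_add, add_mul, mul_one, one_mul, mul_neg, neg_mul, hLs]

end SkewPairCalc

end Literature.LinearAlgebra

namespace Literature.AlgebraicGeometry.HodgeTheory

/-! ### §0 (private) polynomial and spectral calculus -/

section Aux

variable {M : Type*} [AddCommGroup M] [Module ℂ M]

/-- `L ∘ q(f) = q(g) ∘ L` when `L ∘ f = g ∘ L`. [folklore] -/
private theorem map_aeval_apply_of_semiconj {N : Type*} [AddCommGroup N] [Module ℂ N] (L : M →ₗ[ℂ] N)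
    (f : Module.End ℂ M) (g : Module.End ℂ N) (hc : ∀ v, L (f v) = g (L v)) (q : ℂ[X]) (v : M) :
    L (aeval f q v) = aeval g q (L v) := by
  induction q using Polynomial.induction_on' generalizing v with
  | add p q hp hq => rw [map_add, map_add, LinearMap.add_apply, LinearMap.add_apply, map_add, hp, hq]
  | monomial k c =>
    rw [aeval_monomial, aeval_monomial, Module.End.mul_apply, Module.End.mul_apply,
      Module.algebraMap_end_apply, Module.algebraMap_end_apply, map_smul]
    congr 1
    induction k generalizing v with
    | zero => rw [pow_zero, pow_zero, Module.End.one_apply, Module.End.one_apply]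
    | succ k ih => rw [pow_succ, pow_succ, Module.End.mul_apply, Module.End.mul_apply, ih, hc]

/-- `q(T)` commutes with `U` when `T` does. [folklore] -/
private theorem aeval_comm_of_comm (T U : Module.End ℂ M) (hc : T * U = U * T) (q : ℂ[X]) :
    aeval T q * U = U * aeval T q := by
  refine LinearMap.ext fun v ↦ ?_
  rw [Module.End.mul_apply, Module.End.mul_apply]
  exact (map_aeval_apply_of_semiconj U T T (fun v ↦ by rw [← Module.End.mul_apply, ← hc, Module.End.mul_apply]) q v).symm

/-- A polynomial in a `B`-self-adjoint operator is `B`-self-adjoint, for any bilinear map `B`. [folklore] -/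
private theorem pairing_aeval_symm {W : Type*} [AddCommGroup W] [Module ℂ W] (B : M →ₗ[ℂ] M →ₗ[ℂ] W)
    (T : Module.End ℂ M) (hT : ∀ v w, B (T v) w = B v (T w)) (q : ℂ[X]) (v w : M) :
    B (aeval T q v) w = B v (aeval T q w) := by
  induction q using Polynomial.induction_on' generalizing v w with
  | add p q hp hq => rw [map_add, LinearMap.add_apply, LinearMap.add_apply, map_add, LinearMap.add_apply, map_add, hp, hq]
  | monomial k c =>
    rw [aeval_monomial, Module.End.mul_apply, Module.End.mul_apply, Module.algebraMap_end_apply,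
      Module.algebraMap_end_apply, map_smul, LinearMap.smul_apply, map_smul]
    congr 1
    induction k generalizing v w with
    | zero => rw [pow_zero, Module.End.one_apply, Module.End.one_apply]
    | succ k ih =>
      conv_lhs => rw [pow_succ', Module.End.mul_apply]
      rw [hT, ih, ← Module.End.mul_apply, ← pow_succ]

/-- Functional calculus on an eigen-idempotent: `T P = z P ⟹ q(T) P = q(z) P`. [folklore] -/
private theorem aeval_mul_eq_eval_smul {T P : Module.End ℂ M} {z : ℂ} (hTP : T * P = z • P) (q : ℂ[X]) :
    aeval T q * P = q.eval z • P := by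
  induction q using Polynomial.induction_on' with
  | add p q hp hq => rw [map_add, add_mul, hp, hq, eval_add, add_smul]
  | monomial k c =>
    have hk : ∀ k : ℕ, T ^ k * P = z ^ k • P := by
      intro k
      induction k with
      | zero => rw [pow_zero, pow_zero, one_mul, one_smul]
      | succ k ih => rw [pow_succ, mul_assoc, hTP, mul_smul_comm, ih, smul_smul, pow_succ, mul_comm z]
    rw [aeval_monomial, eval_monomial, mul_assoc, hk, Algebra.algebraMap_eq_smul_one, smul_mul_assoc, one_mul,
      smul_smul]

/-- If `Σ_z P_z = 1`, two operators agreeing on every `P_z` are equal. [folklore] -/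
private theorem eq_of_forall_mul_proj_eq {κ : Type*} {s : Finset κ} {P : κ → Module.End ℂ M}
    (hPsum : ∑ z ∈ s, P z = 1) {L L' : Module.End ℂ M} (hL : ∀ z ∈ s, L * P z = L' * P z) : L = L' := by
  rw [← mul_one L, ← hPsum, Finset.mul_sum, ← mul_one L', ← hPsum, Finset.mul_sum]
  exact Finset.sum_congr rfl hL

/-- `(Σ_w c_w ℓ_w)(z) = c_z` for the Lagrange basis `ℓ_w` of a finite `s ∋ z`. [folklore] -/
private theorem eval_sum_C_mul_basis {s : Finset ℂ} (c : ℂ → ℂ) {z : ℂ} (hz : z ∈ s) :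
    (∑ w ∈ s, C (c w) * Lagrange.basis s id w).eval z = c z := by
  classical
  rw [Polynomial.eval_finsetSum, Finset.sum_eq_single_of_mem z hz fun w _ hwz ↦ ?_]
  · have h1 : (Lagrange.basis s id z).eval z = 1 := Lagrange.eval_basis_self (v := id) (Set.injOn_id _) hz
    rw [eval_mul, eval_C, h1, mul_one]
  · have h0 : (Lagrange.basis s id w).eval z = 0 := Lagrange.eval_basis_of_ne (v := id) hwz hz
    rw [eval_mul, eval_C, h0, mul_zero]

/-- **The normalisation.** If `S² = q(T)`, `S` commutes with `T`, `T` has simple spectrum `s` and `q(z) = c_z² ≠ 0` on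
`s`, then `R = Σ_z c_z⁻¹ P_z ∈ ℂ[T]` satisfies `(S R)² = 1` and `R · (Σ_z c_z P_z) = 1`. [folklore] -/
private theorem sq_normaliser {T S : Module.End ℂ M} {s : Finset ℂ} (hs : s.Nonempty)
    (hTs : aeval T (Lagrange.nodal s id) = 0) {q : ℂ[X]} (hS2 : S * S = aeval T q) (hTS : T * S = S * T)
    {c : ℂ → ℂ} (hc : ∀ z ∈ s, q.eval z = c z * c z) (hc0 : ∀ z ∈ s, c z ≠ 0) :
    S * aeval T (∑ w ∈ s, C ((c w)⁻¹) * Lagrange.basis s id w) *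
        (S * aeval T (∑ w ∈ s, C ((c w)⁻¹) * Lagrange.basis s id w)) = 1 ∧
      aeval T (∑ w ∈ s, C ((c w)⁻¹) * Lagrange.basis s id w) * aeval T (∑ w ∈ s, C (c w) * Lagrange.basis s id w) = 1 := by
  classical
  obtain ⟨hPsum, -, -, hTP⟩ := aeval_lagrange_basis_spectral T s hs hTs
  set R := aeval T (∑ w ∈ s, C ((c w)⁻¹) * Lagrange.basis s id w) with hRdef
  set R' := aeval T (∑ w ∈ s, C (c w) * Lagrange.basis s id w) with hR'def
  have hRP : ∀ z ∈ s, R * aeval T (Lagrange.basis s id z) = (c z)⁻¹ • aeval T (Lagrange.basis s id z) :=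
    fun z hz ↦ by rw [hRdef, aeval_mul_eq_eval_smul (hTP z hz), eval_sum_C_mul_basis (fun w ↦ (c w)⁻¹) hz]
  have hR'P : ∀ z ∈ s, R' * aeval T (Lagrange.basis s id z) = c z • aeval T (Lagrange.basis s id z) :=
    fun z hz ↦ by rw [hR'def, aeval_mul_eq_eval_smul (hTP z hz), eval_sum_C_mul_basis c hz]
  have hRS : R * S = S * R := aeval_comm_of_comm T S hTS _
  refine ⟨?_, ?_⟩
  · have hSS : S * R * (S * R) = aeval T q * (R * R) := by
      rw [mul_assoc, ← mul_assoc R S, hRS, mul_assoc, ← mul_assoc S S, hS2]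
    refine eq_of_forall_mul_proj_eq hPsum fun z hz ↦ ?_
    rw [hSS, one_mul, mul_assoc, mul_assoc, hRP z hz, mul_smul_comm, hRP z hz, smul_smul, mul_smul_comm,
      aeval_mul_eq_eval_smul (hTP z hz), smul_smul, hc z hz,
      show (c z)⁻¹ * (c z)⁻¹ * (c z * c z) = 1 by field_simp [hc0 z hz], one_smul]
  · refine eq_of_forall_mul_proj_eq hPsum fun z hz ↦ ?_
    rw [one_mul, mul_assoc, hR'P z hz, mul_smul_comm, hRP z hz, smul_smul, mul_inv_cancel₀ (hc0 z hz), one_smul]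

end Aux

/-- The complex roots of a monic integer polynomial irreducible over `ℚ` are simple and non-empty, with nodal
polynomial the polynomial itself. [folklore] -/
private theorem nodal_roots_toFinset {Q : Polynomial ℤ} (hQm : Q.Monic)
    (hQirr : Irreducible (Q.map (Int.castRingHom ℚ))) :
    Lagrange.nodal (Q.map (Int.castRingHom ℂ)).roots.toFinset id = Q.map (Int.castRingHom ℂ) ∧
      (Q.map (Int.castRingHom ℂ)).roots.toFinset.Nonempty := by
  classical
  have hQc : Q.map (Int.castRingHom ℂ) = (Q.map (Int.castRingHom ℚ)).map (algebraMap ℚ ℂ) := by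
    rw [Polynomial.map_map, RingHom.ext_int ((algebraMap ℚ ℂ).comp (Int.castRingHom ℚ)) (Int.castRingHom ℂ)]
  have hsep : (Q.map (Int.castRingHom ℂ)).Separable := by
    rw [hQc]
    exact hQirr.separable.map
  have hmon : (Q.map (Int.castRingHom ℂ)).Monic := hQm.map _
  have hnodup : (Q.map (Int.castRingHom ℂ)).roots.Nodup := Polynomial.nodup_roots hsep
  refine ⟨?_, ?_⟩
  · have hsplit := (IsAlgClosed.splits (Q.map (Int.castRingHom ℂ))).eq_prod_roots_of_monic hmon
    rw [Lagrange.nodal_eq, ← Multiset.toFinset_eq hnodup, Finset.prod_mk]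
    exact hsplit.symm
  · have hdeg : (Q.map (Int.castRingHom ℂ)).degree ≠ 0 := by
      have h1 : 0 < (Q.map (Int.castRingHom ℚ)).natDegree :=
        Polynomial.natDegree_pos_iff_degree_pos.2 (Polynomial.degree_pos_of_irreducible hQirr)
      rw [hQm.natDegree_map] at h1
      intro h0
      rw [Polynomial.degree_eq_natDegree hmon.ne_zero, hQm.natDegree_map] at h0
      exact h1.ne' (by exact_mod_cast h0)
    obtain ⟨z, hz⟩ := IsAlgClosed.exists_root _ hdeg
    exact ⟨z, Multiset.mem_toFinset.2 ((Polynomial.mem_roots hmon.ne_zero).2 hz)⟩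


/-! ### §2 Slot lemmas on `X = A^{n+1}`: `(πₐ ≫ ι_b)^*`, skew diagonals, the `T`-eigenspaces inside a slot -/

section Slots

variable {A : AbelianVariety ℂ} {h : complexBetti A.X 2} {n : ℕ}

/-- `(πₐ ≫ ι_b)^* x = πₐ^* (ι_b^* x)`. [folklore] -/
private theorem pullbackOne_π_comp_ι_apply'' (a b : Fin (n + 1)) (x : complexBetti (⨁ (fun _ : Fin (n + 1) => A)).X 1) :
    pullbackOne (⨁ (fun _ : Fin (n + 1) => A))
      (biproduct.π (fun _ : Fin (n + 1) => A) a ≫ biproduct.ι (fun _ : Fin (n + 1) => A) b) x =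
      complexBetti.map (biproduct.π (fun _ : Fin (n + 1) => A) a).hom.hom.hom 1
          (complexBetti.map (biproduct.ι (fun _ : Fin (n + 1) => A) b).hom.hom.hom 1 x) := by
  change singularCohomology.map ℂ ℂ _ 1 x = singularCohomology.map ℂ ℂ _ 1 (singularCohomology.map ℂ ℂ _ 1 x)
  rw [abelianVarietyHom_map_map_apply]

/-- `ι_c^* (⊕g)^* = g_c^* ι_c^*` on `H¹` (`ι_c ≫ ⊕g = g_c ≫ ι_c`). [cite: LangeBirkenhake1992, §1.1] -/
private theorem map_ι_pullbackOne_biproductMap' (g : Fin (n + 1) → (A ⟶ A)) (i : Fin (n + 1))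
    (x : complexBetti (⨁ (fun _ : Fin (n + 1) => A)).X 1) :
    complexBetti.map (biproduct.ι (fun _ : Fin (n + 1) => A) i).hom.hom.hom 1
        (pullbackOne (⨁ (fun _ : Fin (n + 1) => A)) (biproduct.map g) x) =
      pullbackOne A (g i) (complexBetti.map (biproduct.ι (fun _ : Fin (n + 1) => A) i).hom.hom.hom 1 x) := by
  change (complexBetti.map (biproduct.map g).hom.hom.hom 1 ≫
      complexBetti.map (biproduct.ι (fun _ : Fin (n + 1) => A) i).hom.hom.hom 1) x =
    (complexBetti.map (biproduct.ι (fun _ : Fin (n + 1) => A) i).hom.hom.hom 1 ≫ complexBetti.map (g i).hom.hom.hom 1) x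
  rw [← complexBetti.map_comp, ← complexBetti.map_comp]
  change (complexBetti.map (biproduct.ι (fun _ : Fin (n + 1) => A) i ≫ biproduct.map g).hom.hom.hom 1) x =
    (complexBetti.map (g i ≫ biproduct.ι (fun _ : Fin (n + 1) => A) i).hom.hom.hom 1) x
  rw [biproduct.ι_map]

/-- **The diagonal of a negative is the negative of the diagonal**: `(⊕(-f))^* = -(⊕f)^*` (additivity of `biproduct.map`
and of the cohomology representation `f ↦ f^*`). [cite: LangeBirkenhake1992, §1.1 (the rational representation is a ring homomorphism)] -/
theorem pullbackOne_biproductMap_const_neg_eq (f : A ⟶ A) :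
    pullbackOne (⨁ (fun _ : Fin (n + 1) => A)) (biproduct.map fun _ : Fin (n + 1) => -f) =
      -pullbackOne (⨁ (fun _ : Fin (n + 1) => A)) (biproduct.map fun _ : Fin (n + 1) => f) := by
  have hneg : (biproduct.map fun _ : Fin (n + 1) => -f) = -(biproduct.map fun _ : Fin (n + 1) => f) :=
    biproduct.hom_ext _ _ fun j ↦ by rw [biproduct.map_π, Preadditive.neg_comp, biproduct.map_π, Preadditive.comp_neg]
  rw [hneg, pullbackOne_neg_eq_neg]

/-- **A ROSATI-SKEW `g` HAS ROSATI-SKEW DIAGONAL `⊕g`** for the product polarization `D = Σ πᵢ^* h` on `A^{n+1}`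
(`0 < dim A`): `Q_D((⊕g)^* v, w) = -Q_D(v, (⊕g)^* w)` (the tree's `polarizationPairingOne_biproductMap_of_adjoint` with
the adjoint pair `(g, -g)`).  For `g = α, β` the skew generators of a definite quaternion algebra.
[cite: Milne1999LefschetzClasses, §1 p. 643] [cite: LangeBirkenhake1992, §5.3] -/
theorem polarizationPairingOne_biproductMap_const_of_skew (hA : 0 < A.dim) (g : A ⟶ A)
    (hg : ∀ a b : complexBetti A.X 1, polarizationPairingOne A.X h (A.dim - 1) (pullbackOne A g a) b =
      -polarizationPairingOne A.X h (A.dim - 1) a (pullbackOne A g b))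
    (v w : complexBetti (⨁ (fun _ : Fin (n + 1) => A)).X 1) :
    polarizationPairingOne (⨁ (fun _ : Fin (n + 1) => A)).X (sumPolarizationClass (fun _ : Fin (n + 1) => A) fun _ => h)
        ((⨁ (fun _ : Fin (n + 1) => A)).dim - 1)
        (pullbackOne (⨁ (fun _ : Fin (n + 1) => A)) (biproduct.map fun _ : Fin (n + 1) => g) v) w =
      -polarizationPairingOne (⨁ (fun _ : Fin (n + 1) => A)).X (sumPolarizationClass (fun _ : Fin (n + 1) => A) fun _ => h)
        ((⨁ (fun _ : Fin (n + 1) => A)).dim - 1) v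
        (pullbackOne (⨁ (fun _ : Fin (n + 1) => A)) (biproduct.map fun _ : Fin (n + 1) => g) w) := by
  have key := polarizationPairingOne_biproductMap_of_adjoint (fun _ : Fin (n + 1) => A) (fun _ => h) (fun _ => hA)
    (fun _ => g) (fun _ => -g) (fun i a b ↦ by
      change polarizationPairingOne A.X h (A.dim - 1) (pullbackOne A g a) b =
        polarizationPairingOne A.X h (A.dim - 1) a (pullbackOne A (-g) b)
      rw [hg, pullbackOne_neg_eq_neg, LinearMap.neg_apply, map_neg]) v w
  change polarizationPairingOne _ _ _ (pullbackOne (⨁ (fun _ : Fin (n + 1) => A)) (biproduct.map fun _ => g) v) w =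
    polarizationPairingOne _ _ _ v (pullbackOne (⨁ (fun _ : Fin (n + 1) => A)) (biproduct.map fun _ => -g) w) at key
  rw [key, pullbackOne_biproductMap_const_neg_eq, LinearMap.neg_apply, map_neg]

/-- **The `z`-eigenspace of the diagonal `(⊕ψ)^*` inside one slot `e_{cc} H¹(A^{n+1}) = π_c^* H¹(A)` has the dimension
of the `z`-eigenspace of `ψ^*` on `H¹(A)`** (`π_c^*` is injective with left inverse `ι_c^*` and intertwines `ψ^*` with
`(⊕ψ)^*`). [cite: LangeBirkenhake1992, §1.1] [cite: HatcherAT2002, §3.2 Thm. 3.16] -/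
theorem finrank_range_π_comp_ι_inf_eigenspace_biproductMap_eq (ψ : A ⟶ A) (c : Fin (n + 1)) (z : ℂ) :
    Module.finrank ℂ ↥(LinearMap.range (pullbackOne (⨁ (fun _ : Fin (n + 1) => A))
        (biproduct.π (fun _ : Fin (n + 1) => A) c ≫ biproduct.ι (fun _ : Fin (n + 1) => A) c)) ⊓
        (pullbackOne (⨁ (fun _ : Fin (n + 1) => A)) (biproduct.map fun _ : Fin (n + 1) => ψ)).eigenspace z) =
      Module.finrank ℂ ↥((pullbackOne A ψ).eigenspace z) := by
  set X := ⨁ (fun _ : Fin (n + 1) => A) with hXdef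
  set πs : complexBetti A.X 1 →ₗ[ℂ] complexBetti X.X 1 :=
    (complexBetti.map (biproduct.π (fun _ : Fin (n + 1) => A) c).hom.hom.hom 1).hom with hπs
  set ιs : complexBetti X.X 1 →ₗ[ℂ] complexBetti A.X 1 :=
    (complexBetti.map (biproduct.ι (fun _ : Fin (n + 1) => A) c).hom.hom.hom 1).hom with hιs
  set T : Module.End ℂ (complexBetti X.X 1) := pullbackOne X (biproduct.map fun _ : Fin (n + 1) => ψ) with hTdef
  set U : Module.End ℂ (complexBetti X.X 1) :=
    pullbackOne X (biproduct.π (fun _ : Fin (n + 1) => A) c ≫ biproduct.ι (fun _ : Fin (n + 1) => A) c) with hUdef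
  have hU : ∀ v, U v = πs (ιs v) := fun v ↦ pullbackOne_π_comp_ι_apply'' c c v
  have hιπ : ∀ w, ιs (πs w) = w := fun w ↦ map_ι_map_π_self (fun _ : Fin (n + 1) => A) c w
  have hTπ : ∀ w, T (πs w) = πs (pullbackOne A ψ w) := fun w ↦
    map_biproductMap_map_π (fun _ : Fin (n + 1) => A) (fun _ => ψ) c 1 w
  have hιT : ∀ v, ιs (T v) = pullbackOne A ψ (ιs v) := fun v ↦ map_ι_pullbackOne_biproductMap' (fun _ => ψ) c v
  have hinj : Function.Injective πs := fun a b hab ↦ by rw [← hιπ a, ← hιπ b, hab]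
  have hkey : LinearMap.range U ⊓ T.eigenspace z = ((pullbackOne A ψ).eigenspace z).map πs := by
    refine le_antisymm ?_ ?_
    · rintro v ⟨⟨v', hv'⟩, hv⟩
      have hvv : v = πs (ιs v) := by
        rw [← hU, ← hv', ← Module.End.mul_apply, hUdef, pullbackOne_π_comp_ι_mul, if_pos rfl]
      have hv2 : T v = z • v := Module.End.mem_eigenspace_iff.1 hv
      refine ⟨ιs v, ?_, hvv.symm⟩
      rw [SetLike.mem_coe, Module.End.mem_eigenspace_iff, ← hιT, hv2, map_smul]
    · rintro _ ⟨w, hw, rfl⟩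
      have hw2 : pullbackOne A ψ w = z • w := Module.End.mem_eigenspace_iff.1 hw
      refine ⟨⟨πs w, by rw [hU, hιπ]⟩, ?_⟩
      change πs w ∈ T.eigenspace z
      rw [Module.End.mem_eigenspace_iff, hTπ, hw2, map_smul]
  rw [hkey]
  exact (LinearEquiv.finrank_eq (Submodule.equivMapOfInjective πs hinj _)).symm

end Slots

/-! ### §3 Lagrange projectors of a commuting operator: `P_z f V = f V ∩ ker(T - z)` -/

section Proj

variable {M : Type*} [AddCommGroup M] [Module ℂ M]

/-- For `f` commuting with an operator `T` of simple spectrum `s ∋ z` and `P_z = ℓ_z(T)`: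
`(P_z f) V = f V ∩ ker(T - z)`. [cite: HornJohnson2013, §1.1 and Thm. 1.3.7 ff.] -/
theorem range_aeval_lagrange_basis_mul_eq_of_comm {T f : Module.End ℂ M} {s : Finset ℂ} (hs : s.Nonempty)
    (hTs : aeval T (Lagrange.nodal s id) = 0) (hTf : T * f = f * T) {z : ℂ} (hz : z ∈ s) :
    LinearMap.range (aeval T (Lagrange.basis s id z) * f) = LinearMap.range f ⊓ T.eigenspace z := by
  have hPf : aeval T (Lagrange.basis s id z) * f = f * aeval T (Lagrange.basis s id z) := aeval_comm_of_comm T f hTf _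
  obtain ⟨-, -, hPidem, -⟩ := aeval_lagrange_basis_spectral T s hs hTs
  rw [← range_aeval_lagrange_basis_eq_eigenspace hs hTs hz]
  refine le_antisymm ?_ ?_
  · rintro _ ⟨v, rfl⟩
    exact ⟨⟨aeval T (Lagrange.basis s id z) v, by rw [← Module.End.mul_apply, ← hPf]⟩, ⟨f v, rfl⟩⟩
  · rintro v ⟨⟨v', hv'⟩, ⟨v'', hv''⟩⟩
    refine ⟨v', ?_⟩
    rw [Module.End.mul_apply, hv', ← hv'', ← Module.End.mul_apply, hPidem _ hz]

end Proj

/-! ### §4 THE TYPE-3 ROW ON POWERS: `F ⊆ M_{n+1}(D)`, `D = ℚ(ψ)⟨α, β⟩` DEFINITE, even exponents ⟹ `W_F` decomposable -/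

section DefiniteQuaternionMatrices

variable {A : AbelianVariety ℂ} {h : complexBetti A.X 2} {n : ℕ} {ψ α β : A ⟶ A} {qa qb : ℂ[X]}
  {φ : ⨁ (fun _ : Fin (n + 1) => A) ⟶ ⨁ (fun _ : Fin (n + 1) => A)} {P Q : Polynomial ℤ} {e m : ℕ}

set_option maxHeartbeats 400000 in
/-- **MOONEN–ZARHIN's CRITERION (2), TYPE 3 ON POWERS — `W_F(A^{n+1})` IS DECOMPOSABLE FOR `F ⊆ M_{n+1}(D)`,
`D = ℚ(ψ)⟨α, β⟩` A DEFINITE QUATERNION ALGEBRA OVER THE REAL-MULTIPLICATION FIELD `ℚ(ψ)`, WHEN EVERY PER-PLACE EXPONENT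
IS EVEN.**  Let `A` be a complex abelian variety of positive dimension with `h ∈ B¹(A) ⊗ ℂ`, `h^{dim A} ≠ 0`, `Q_h`
non-degenerate; `ψ ∈ End(A)` ROSATI-SYMMETRIC with `Q(ψ) = 0`, `Q ∈ ℤ[T]` monic irreducible over `ℚ` (the totally real
centre `E = ℚ(ψ)`, of any degree); `α, β ∈ End(A)` ROSATI-SKEW (`α† = -α`, `β† = -β`: quaternion conjugation, the
positive involution of a definite quaternion algebra), commuting with `ψ^*`, ANTICOMMUTING, with `α^{*2} = a(ψ^*)`,
`β^{*2} = b(ψ^*)` for polynomials `a, b` not vanishing at any complex root of `Q` (`α², β² ∈ E^×`); let `X = A^{n+1}`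
carry the product polarization `D_X = Σ πᵢ^* h`, and `φ ∈ End(X)` have `φ^*` in the complex algebra generated by the
diagonals `(⊕ψ)^*, (⊕α)^*, (⊕β)^*` and the matrix units `(πₐ ≫ ι_b)^*` — `F = ℚ(φ) ⊆ M_{n+1}(D)` — with `P(φ) = 0`,
`P ∈ ℤ[T]` monic irreducible of degree `e`, `e · 2m = 2(n+1) dim A`.  IF for every complex root `ρ` of `P` and every
complex root `z` of `Q` the dimension `dim_ℂ ker(ψ^* - z)` (on `H¹(A)`) divides `dim_ℂ (V_ρ ∩ ker((⊕ψ)^* - z))`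
(on `H¹(X)`) — the exponent `l_z(ρ) = dim(V_ρ ∩ V_X^{(z)}) / ½ dim V_A^{(z)}` of the print's `O_{2k}`-factor at the
place `z` is EVEN — THEN `W_F ⊗ ℂ ≤ 𝒟ᵐ ⊗ ℂ`: all Weil classes of `F` are decomposable.  Proof — as the seat's type-2
file `WeilClassesFieldQuaternionOverRealFieldMatricesDecomposable`, with the Rosati sign flipped: normalise
`S = (⊕α)^* a(T)^{-1/2}`, `T′ = (⊕β)^* b(T)^{-1/2}` place by place (`S² = T′² = 1`, `S T′ = -T′ S`, both
`Q_{D_X}`-SKEW, `T = (⊕ψ)^*`); the datum `(x′, y′, p′, t′)` of `exists_moritaData_cornerForm_of_skew_anticommuting_pair`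
(ISOTROPIC corner `p′V`, corner operator `t′`); the combined datum `x_{(i,c)} = e_{i0} x′_c`, `y_{(i,c)} = y′_c e_{0i}`,
`p = e_{00} p′` over `Fin (n+1) × Fin 2` with corner operator `t′` (symmetric form `Q_{D_X}(·, t′ ·)`, non-degenerate on
`pV`); the corner dimension `2 dim(pV ∩ ker(T - z)) = dim ker(ψ^* - z)` (§1–§3: `t′` exchanges the two corners, `e_{00}`
is the slot `π_0^* H¹(A)`); then `weilClassesField_le_divisorClassesSpan_of_moritaData_of_cornerForm_of_symmetric_of_even`.
This is the print's row «`Y` of Type 3, `m ≥ 2`» with its parity condition read PLACE BY PLACE (`Σ_z l_z(ρ) =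
2m[E:ℚ]/[F:ℚ]` is the print's integer; see the honest column of `WeilClassesFieldOrthogonalCornersParity`), for a
centre of ANY degree, ANY definite quaternion algebra so presented, ANY `m = n + 1 ≥ 1`, on the carrier, with no
algebraic groups, connectedness or `π₀`. [cite: MoonenZarhin1998WeilClasses, §1 Criterion (2), case «Type 3, m ≥ 2» and its proof (chunk p0003 L46–L60, L92–L111; p0004 L1–L27); Lemma (2), Tables 1–2 (chunk p0002 L60–L118, p0003 L1–L4)]
[cite: Milne1999LefschetzClasses, §1 p. 643, Thm. 3.2, Cor. 4.5] [cite: McconnellRobson2001, 3.5.5–3.5.7] [cite: HornJohnson2013, §1.1 and §1.3] -/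
theorem weilClassesField_biproduct_le_divisorClassesSpan_of_mem_adjoin_definiteQuaternionOver_diagonal_of_dvd
    (hA : 0 < A.dim) (hh : h ∈ hodgeClassSpan A.dim A.X 1) (htop : lefschetzPow h (A.dim - 1) 2 h ≠ 0)
    (hnd : ∀ x : complexBetti A.X 1, (∀ y, polarizationPairingOne A.X h (A.dim - 1) x y = 0) → x = 0)
    (hψsym : ∀ v w : complexBetti A.X 1, polarizationPairingOne A.X h (A.dim - 1) (pullbackOne A ψ v) w =
      polarizationPairingOne A.X h (A.dim - 1) v (pullbackOne A ψ w))
    (hQm : Q.Monic) (hQirr : Irreducible (Q.map (Int.castRingHom ℚ)))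
    (hψQ : Polynomial.eval₂ (Int.castRingHom (CategoryTheory.End A)) (ψ : CategoryTheory.End A) Q = 0)
    (hα2 : pullbackOne A α * pullbackOne A α = aeval (pullbackOne A ψ) qa)
    (hqa : ∀ z : ℂ, (Q.map (Int.castRingHom ℂ)).IsRoot z → qa.eval z ≠ 0)
    (hβ2 : pullbackOne A β * pullbackOne A β = aeval (pullbackOne A ψ) qb)
    (hqb : ∀ z : ℂ, (Q.map (Int.castRingHom ℂ)).IsRoot z → qb.eval z ≠ 0)
    (hanti : pullbackOne A α * pullbackOne A β = -(pullbackOne A β * pullbackOne A α))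
    (hαskew : ∀ v w : complexBetti A.X 1, polarizationPairingOne A.X h (A.dim - 1) (pullbackOne A α v) w =
      -polarizationPairingOne A.X h (A.dim - 1) v (pullbackOne A α w))
    (hβskew : ∀ v w : complexBetti A.X 1, polarizationPairingOne A.X h (A.dim - 1) (pullbackOne A β v) w =
      -polarizationPairingOne A.X h (A.dim - 1) v (pullbackOne A β w))
    (hψα : pullbackOne A ψ * pullbackOne A α = pullbackOne A α * pullbackOne A ψ)
    (hψβ : pullbackOne A ψ * pullbackOne A β = pullbackOne A β * pullbackOne A ψ)
    (hPm : P.Monic) (hPe : P.natDegree = e) (hPirr : Irreducible (P.map (Int.castRingHom ℚ)))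
    (hφ : Polynomial.eval₂ (Int.castRingHom (CategoryTheory.End (⨁ (fun _ : Fin (n + 1) => A))))
      (φ : CategoryTheory.End (⨁ (fun _ : Fin (n + 1) => A))) P = 0)
    (her : e * (2 * m) = 2 * ((n + 1) * A.dim))
    (hF : pullbackOne (⨁ (fun _ : Fin (n + 1) => A)) φ ∈ Algebra.adjoin ℂ
      (insert (pullbackOne (⨁ (fun _ : Fin (n + 1) => A)) (biproduct.map fun _ : Fin (n + 1) => ψ))
        (insert (pullbackOne (⨁ (fun _ : Fin (n + 1) => A)) (biproduct.map fun _ : Fin (n + 1) => α))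
          (insert (pullbackOne (⨁ (fun _ : Fin (n + 1) => A)) (biproduct.map fun _ : Fin (n + 1) => β))
            (Set.range fun ab : Fin (n + 1) × Fin (n + 1) ↦ pullbackOne (⨁ (fun _ : Fin (n + 1) => A))
              (biproduct.π (fun _ : Fin (n + 1) => A) ab.1 ≫ biproduct.ι (fun _ : Fin (n + 1) => A) ab.2))))))
    (hdvd : ∀ ρ : ℂ, Polynomial.eval₂ (Int.castRingHom ℂ) ρ P = 0 → ∀ z : ℂ, (Q.map (Int.castRingHom ℂ)).IsRoot z →
      Module.finrank ℂ ↥((pullbackOne A ψ).eigenspace z) ∣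
        Module.finrank ℂ ↥((pullbackOne (⨁ (fun _ : Fin (n + 1) => A)) φ).eigenspace ρ ⊓
          (pullbackOne (⨁ (fun _ : Fin (n + 1) => A)) (biproduct.map fun _ : Fin (n + 1) => ψ)).eigenspace z)) :
    weilClassesField (⨁ (fun _ : Fin (n + 1) => A)) φ P (2 * m) ≤
      divisorClassesSpan (⨁ (fun _ : Fin (n + 1) => A)).X (⨁ (fun _ : Fin (n + 1) => A)).dim m := by
  classical
  obtain ⟨hhX, -, hndX⟩ := sumPolarizationClass_hypotheses (fun _ : Fin (n + 1) => A) (fun _ => h)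
      (fun _ => hA) (fun _ => hh) (fun _ => htop) (fun _ => hnd)
  have herX : e * (2 * m) = 2 * (⨁ (fun _ : Fin (n + 1) => A)).dim := by rw [dim_biproduct_const_succ A n, her]
  -- notation (`(⨁ (fun _ : Fin (n + 1) => A)) = A^{n+1}` is spelled out: `set` would shadow `φ`)
  haveI : Module.Finite ℂ (complexBetti (⨁ (fun _ : Fin (n + 1) => A)).X 1) :=
    abelianVarietyCohomologyExteriorH1_holds.finite_one _
  set D := sumPolarizationClass (fun _ : Fin (n + 1) => A) (fun _ => h) with hDdef
  set T : Module.End ℂ (complexBetti (⨁ (fun _ : Fin (n + 1) => A)).X 1) := pullbackOne (⨁ (fun _ : Fin (n + 1) => A)) (biproduct.map fun _ : Fin (n + 1) => ψ) with hTdef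
  set Sa : Module.End ℂ (complexBetti (⨁ (fun _ : Fin (n + 1) => A)).X 1) := pullbackOne (⨁ (fun _ : Fin (n + 1) => A)) (biproduct.map fun _ : Fin (n + 1) => α) with hSadef
  set Sb : Module.End ℂ (complexBetti (⨁ (fun _ : Fin (n + 1) => A)).X 1) := pullbackOne (⨁ (fun _ : Fin (n + 1) => A)) (biproduct.map fun _ : Fin (n + 1) => β) with hSbdef
  set U : Fin (n + 1) → Fin (n + 1) → Module.End ℂ (complexBetti (⨁ (fun _ : Fin (n + 1) => A)).X 1) := fun a b ↦
    pullbackOne (⨁ (fun _ : Fin (n + 1) => A)) (biproduct.π (fun _ : Fin (n + 1) => A) a ≫ biproduct.ι (fun _ : Fin (n + 1) => A) b) with hUdef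
  -- the ambient algebra: the pull-back algebra `𝔄 = ℂ⟨χ^* : χ ∈ End((⨁ (fun _ : Fin (n + 1) => A)))⟩`
  set 𝔄 : Subalgebra ℂ (Module.End ℂ (complexBetti (⨁ (fun _ : Fin (n + 1) => A)).X 1)) :=
    Algebra.adjoin ℂ (Set.range fun χ : (⨁ (fun _ : Fin (n + 1) => A)) ⟶ (⨁ (fun _ : Fin (n + 1) => A)) ↦ pullbackOne (⨁ (fun _ : Fin (n + 1) => A)) χ) with h𝔄def
  have hU : ∀ a b c d, U a b * U c d = if b = c then U a d else 0 := fun a b c d ↦ pullbackOne_π_comp_ι_mul a b c d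
  have hUsum : ∑ a, U a a = 1 := sum_pullbackOne_π_comp_ι
  have hUadj : ∀ a b (v w : complexBetti (⨁ (fun _ : Fin (n + 1) => A)).X 1), polarizationPairingOne (⨁ (fun _ : Fin (n + 1) => A)).X D ((⨁ (fun _ : Fin (n + 1) => A)).dim - 1) (U a b v) w =
      polarizationPairingOne (⨁ (fun _ : Fin (n + 1) => A)).X D ((⨁ (fun _ : Fin (n + 1) => A)).dim - 1) v (U b a w) :=
    fun a b v w ↦ polarizationPairingOne_pullbackOne_π_comp_ι hA hh htop hnd a b v w
  have hU𝔄 : ∀ a b, U a b ∈ 𝔄 := fun a b ↦ Algebra.subset_adjoin ⟨_, rfl⟩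
  have hT𝔄 : T ∈ 𝔄 := Algebra.subset_adjoin ⟨_, rfl⟩
  have hSa𝔄 : Sa ∈ 𝔄 := Algebra.subset_adjoin ⟨_, rfl⟩
  have hSb𝔄 : Sb ∈ 𝔄 := Algebra.subset_adjoin ⟨_, rfl⟩
  -- the diagonals: `T` symmetric, `Sa`, `Sb` skew
  have hT_symm : T ∈ symmetricPullbackSpan (⨁ (fun _ : Fin (n + 1) => A)) D :=
    pullbackOne_biproductMap_mem_symmetricPullbackSpan (fun _ : Fin (n + 1) => A) (fun _ => h) (fun _ => hA)
      (fun _ => ψ) (fun _ => hψsym)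
  have hSa_skew : ∀ v w : complexBetti (⨁ (fun _ : Fin (n + 1) => A)).X 1, polarizationPairingOne (⨁ (fun _ : Fin (n + 1) => A)).X D ((⨁ (fun _ : Fin (n + 1) => A)).dim - 1) (Sa v) w =
      -polarizationPairingOne (⨁ (fun _ : Fin (n + 1) => A)).X D ((⨁ (fun _ : Fin (n + 1) => A)).dim - 1) v (Sa w) :=
    fun v w ↦ polarizationPairingOne_biproductMap_const_of_skew hA α hαskew v w
  have hSb_skew : ∀ v w : complexBetti (⨁ (fun _ : Fin (n + 1) => A)).X 1, polarizationPairingOne (⨁ (fun _ : Fin (n + 1) => A)).X D ((⨁ (fun _ : Fin (n + 1) => A)).dim - 1) (Sb v) w =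
      -polarizationPairingOne (⨁ (fun _ : Fin (n + 1) => A)).X D ((⨁ (fun _ : Fin (n + 1) => A)).dim - 1) v (Sb w) :=
    fun v w ↦ polarizationPairingOne_biproductMap_const_of_skew hA β hβskew v w
  have hSanti : Sa * Sb = -(Sb * Sa) := pullbackOne_biproductMap_const_mul_eq_neg hanti
  have hTSa : T * Sa = Sa * T := pullbackOne_biproductMap_const_comm hψα
  have hTSb : T * Sb = Sb * T := pullbackOne_biproductMap_const_comm hψβ
  have hTU : ∀ c d, T * U c d = U c d * T := fun c d ↦ pullbackOne_biproductMap_const_mul_π_comp_ι ψ c d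
  have hSaU : ∀ c d, Sa * U c d = U c d * Sa := fun c d ↦ pullbackOne_biproductMap_const_mul_π_comp_ι α c d
  have hSbU : ∀ c d, Sb * U c d = U c d * Sb := fun c d ↦ pullbackOne_biproductMap_const_mul_π_comp_ι β c d
  -- the square relations `(⊕γ)^{*2} = q((⊕ψ)^*)` transfer slotwise
  have hsq : ∀ {γ : A ⟶ A} {q : ℂ[X]}, pullbackOne A γ * pullbackOne A γ = aeval (pullbackOne A ψ) q →
      pullbackOne (⨁ (fun _ : Fin (n + 1) => A)) (biproduct.map fun _ : Fin (n + 1) => γ) * pullbackOne (⨁ (fun _ : Fin (n + 1) => A)) (biproduct.map fun _ : Fin (n + 1) => γ) =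
        aeval T q := by
    intro γ q hγ
    refine LinearMap.ext fun v ↦ ?_
    rw [pullbackOne_biproductMap_const_mul_apply, hγ]
    conv_rhs => rw [← sum_map_π_map_ι (fun _ : Fin (n + 1) => A) v, map_sum]
    refine Finset.sum_congr rfl fun c _ ↦ ?_
    exact (map_aeval_apply_of_semiconj (complexBetti.map (biproduct.π (fun _ : Fin (n + 1) => A) c).hom.hom.hom 1).hom
      (pullbackOne A ψ) T (fun w ↦ (map_biproductMap_map_π (fun _ : Fin (n + 1) => A) (fun _ => ψ) c 1 w).symm) q _)
  have hSa2 : Sa * Sa = aeval T qa := hsq hα2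
  have hSb2 : Sb * Sb = aeval T qb := hsq hβ2
  have hTQ : aeval T (Q.map (Int.castRingHom ℂ)) = 0 := by
    have hψQ' := aeval_hom_complexBetti_map_one_eq_zero hψQ
    refine LinearMap.ext fun v ↦ ?_
    rw [LinearMap.zero_apply, ← sum_map_π_map_ι (fun _ : Fin (n + 1) => A) v, map_sum]
    refine Finset.sum_eq_zero fun c _ ↦ ?_
    have key := map_aeval_apply_of_semiconj (complexBetti.map (biproduct.π (fun _ : Fin (n + 1) => A) c).hom.hom.hom 1).hom
      (pullbackOne A ψ) T (fun w ↦ (map_biproductMap_map_π (fun _ : Fin (n + 1) => A) (fun _ => ψ) c 1 w).symm)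
      (Q.map (Int.castRingHom ℂ)) (complexBetti.map (biproduct.ι (fun _ : Fin (n + 1) => A) c).hom.hom.hom 1 v)
    rw [hψQ', LinearMap.zero_apply, map_zero] at key
    exact key.symm
  set s : Finset ℂ := (Q.map (Int.castRingHom ℂ)).roots.toFinset with hsdef
  obtain ⟨hnodal, hsne⟩ := nodal_roots_toFinset hQm hQirr
  have hTnodal : aeval T (Lagrange.nodal s id) = 0 := by rw [hsdef, hnodal, hTQ]
  have hmem_s : ∀ z ∈ s, (Q.map (Int.castRingHom ℂ)).IsRoot z := fun z hz ↦ by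
    rw [hsdef] at hz
    exact (Polynomial.mem_roots (hQm.map _).ne_zero).1 (Multiset.mem_toFinset.1 hz)
  -- square roots of `a(z)`, `b(z)` at the places `z`
  have hσex : ∀ z : ℂ, ∃ σ : ℂ, qa.eval z = σ * σ := fun z ↦ IsAlgClosed.exists_eq_mul_self _
  have hτex : ∀ z : ℂ, ∃ τ : ℂ, qb.eval z = τ * τ := fun z ↦ IsAlgClosed.exists_eq_mul_self _
  choose σ hσ using hσex
  choose τ hτ using hτex
  have hσ0 : ∀ z ∈ s, σ z ≠ 0 := fun z hz h0 ↦ hqa z (hmem_s z hz) (by rw [hσ z, h0, mul_zero])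
  have hτ0 : ∀ z ∈ s, τ z ≠ 0 := fun z hz h0 ↦ hqb z (hmem_s z hz) (by rw [hτ z, h0, mul_zero])
  -- the normalised pair `S = (⊕α)^* a(T)^{-1/2}`, `T' = (⊕β)^* b(T)^{-1/2}`
  obtain ⟨hS2, hRaRa'⟩ := sq_normaliser hsne hTnodal hSa2 hTSa (fun z hz ↦ hσ z) hσ0
  obtain ⟨hT2, hRbRb'⟩ := sq_normaliser hsne hTnodal hSb2 hTSb (fun z hz ↦ hτ z) hτ0
  set Ra : Module.End ℂ (complexBetti (⨁ (fun _ : Fin (n + 1) => A)).X 1) := aeval T (∑ w ∈ s, C ((σ w)⁻¹) * Lagrange.basis s id w) with hRadef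
  set Ra' : Module.End ℂ (complexBetti (⨁ (fun _ : Fin (n + 1) => A)).X 1) := aeval T (∑ w ∈ s, C (σ w) * Lagrange.basis s id w) with hRa'def
  set Rb : Module.End ℂ (complexBetti (⨁ (fun _ : Fin (n + 1) => A)).X 1) := aeval T (∑ w ∈ s, C ((τ w)⁻¹) * Lagrange.basis s id w) with hRbdef
  set Rb' : Module.End ℂ (complexBetti (⨁ (fun _ : Fin (n + 1) => A)).X 1) := aeval T (∑ w ∈ s, C (τ w) * Lagrange.basis s id w) with hRb'def
  have hRaSa : Ra * Sa = Sa * Ra := aeval_comm_of_comm T Sa hTSa _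
  have hRaSb : Ra * Sb = Sb * Ra := aeval_comm_of_comm T Sb hTSb _
  have hRbSa : Rb * Sa = Sa * Rb := aeval_comm_of_comm T Sa hTSa _
  have hRbSb : Rb * Sb = Sb * Rb := aeval_comm_of_comm T Sb hTSb _
  have hRbT : Rb * T = T * Rb := aeval_comm_of_comm T T rfl _
  have hRaT : Ra * T = T * Ra := aeval_comm_of_comm T T rfl _
  have hRaRb : Ra * Rb = Rb * Ra := aeval_comm_of_comm T Rb hRbT.symm _
  have hRaU : ∀ c d, Ra * U c d = U c d * Ra := fun c d ↦ aeval_comm_of_comm T (U c d) (hTU c d) _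
  have hRbU : ∀ c d, Rb * U c d = U c d * Rb := fun c d ↦ aeval_comm_of_comm T (U c d) (hTU c d) _
  have hRa_adj : ∀ v w : complexBetti (⨁ (fun _ : Fin (n + 1) => A)).X 1, polarizationPairingOne (⨁ (fun _ : Fin (n + 1) => A)).X D ((⨁ (fun _ : Fin (n + 1) => A)).dim - 1) (Ra v) w =
      polarizationPairingOne (⨁ (fun _ : Fin (n + 1) => A)).X D ((⨁ (fun _ : Fin (n + 1) => A)).dim - 1) v (Ra w) := fun v w ↦ pairing_aeval_symm _ T hT_symm.2 _ v w
  have hRb_adj : ∀ v w : complexBetti (⨁ (fun _ : Fin (n + 1) => A)).X 1, polarizationPairingOne (⨁ (fun _ : Fin (n + 1) => A)).X D ((⨁ (fun _ : Fin (n + 1) => A)).dim - 1) (Rb v) w =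
      polarizationPairingOne (⨁ (fun _ : Fin (n + 1) => A)).X D ((⨁ (fun _ : Fin (n + 1) => A)).dim - 1) v (Rb w) := fun v w ↦ pairing_aeval_symm _ T hT_symm.2 _ v w
  have hCT : ∀ q : ℂ[X], aeval T q ∈ 𝔄 := fun q ↦
    Algebra.adjoin_le (Set.singleton_subset_iff.2 hT𝔄) (Polynomial.aeval_mem_adjoin_singleton ℂ T)
  set S : Module.End ℂ (complexBetti (⨁ (fun _ : Fin (n + 1) => A)).X 1) := Sa * Ra with hSdef
  set T' : Module.End ℂ (complexBetti (⨁ (fun _ : Fin (n + 1) => A)).X 1) := Sb * Rb with hT'def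
  have hcm : ∀ {L V W : Module.End ℂ (complexBetti (⨁ (fun _ : Fin (n + 1) => A)).X 1)}, L * V = V * L → L * W = W * L →
      L * (V * W) = V * W * L := fun h1 h2 ↦ by rw [← mul_assoc, h1, mul_assoc, h2, ← mul_assoc]
  have hST : S * T' = -(T' * S) := by
    have e1 : S * T' = Sa * Sb * (Ra * Rb) := by
      rw [hSdef, hT'def, mul_assoc, ← mul_assoc Ra Sb, hRaSb, mul_assoc, ← mul_assoc Sa Sb]
    have e2 : T' * S = Sb * Sa * (Ra * Rb) := by
      rw [hSdef, hT'def, mul_assoc, ← mul_assoc Rb Sa, hRbSa, mul_assoc, ← mul_assoc Sb Sa, hRaRb]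
    rw [e1, e2, hSanti, neg_mul]
  have hS_skew : ∀ v w : complexBetti (⨁ (fun _ : Fin (n + 1) => A)).X 1, polarizationPairingOne (⨁ (fun _ : Fin (n + 1) => A)).X D ((⨁ (fun _ : Fin (n + 1) => A)).dim - 1) (S v) w =
      -polarizationPairingOne (⨁ (fun _ : Fin (n + 1) => A)).X D ((⨁ (fun _ : Fin (n + 1) => A)).dim - 1) v (S w) := by
    intro v w
    rw [hSdef, Module.End.mul_apply, hSa_skew, hRa_adj, ← Module.End.mul_apply, hRaSa]
  have hT'_skew : ∀ v w : complexBetti (⨁ (fun _ : Fin (n + 1) => A)).X 1, polarizationPairingOne (⨁ (fun _ : Fin (n + 1) => A)).X D ((⨁ (fun _ : Fin (n + 1) => A)).dim - 1) (T' v) w =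
      -polarizationPairingOne (⨁ (fun _ : Fin (n + 1) => A)).X D ((⨁ (fun _ : Fin (n + 1) => A)).dim - 1) v (T' w) := by
    intro v w
    rw [hT'def, Module.End.mul_apply, hSb_skew, hRb_adj, ← Module.End.mul_apply, hRbSb]
  have hS_mem : S ∈ 𝔄 := Subalgebra.mul_mem _ hSa𝔄 (hCT _)
  have hT'_mem : T' ∈ 𝔄 := Subalgebra.mul_mem _ hSb𝔄 (hCT _)
  have hS2' : S * S = (1:ℂ) • 1 := by rw [one_smul]; exact hS2
  have hT2' : T' * T' = (1:ℂ) • 1 := by rw [one_smul]; exact hT2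
  have hTS : T * S = S * T := hcm hTSa hRaT.symm
  have hTT' : T * T' = T' * T := hcm hTSb hRbT.symm
  have hUS : ∀ c d, U c d * S = S * U c d := fun c d ↦ hcm (hSaU c d).symm (hRaU c d).symm
  have hUT' : ∀ c d, U c d * T' = T' * U c d := fun c d ↦ hcm (hSbU c d).symm (hRbU c d).symm
  -- the `2 × 2` block of the normalised SKEW pair `S, T'`: `p' = ½(1 + S)`, `q' = ½(1 - S)`, units `(p', T'p')`,
  -- `(p', p'T')`, ISOTROPIC corner `p'V` with partner `q'V = T'(p'V)` and corner operator `t' = T'`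
  have hQskew : ∀ v w : complexBetti (⨁ (fun _ : Fin (n + 1) => A)).X 1, polarizationPairingOne (⨁ (fun _ : Fin (n + 1) => A)).X D ((⨁ (fun _ : Fin (n + 1) => A)).dim - 1) v w =
      -polarizationPairingOne (⨁ (fun _ : Fin (n + 1) => A)).X D ((⨁ (fun _ : Fin (n + 1) => A)).dim - 1) w v := fun v w ↦ by
    have h0 := polarizationPairingOne_self D ((⨁ (fun _ : Fin (n + 1) => A)).dim - 1) (v + w)
    simp only [map_add, LinearMap.add_apply, polarizationPairingOne_self, zero_add, add_zero] at h0
    exact eq_neg_of_add_eq_zero_right h0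
  set p' : Module.End ℂ (complexBetti (⨁ (fun _ : Fin (n + 1) => A)).X 1) := (2:ℂ)⁻¹ • (1 + S) with hp'def
  set q' : Module.End ℂ (complexBetti (⨁ (fun _ : Fin (n + 1) => A)).X 1) := (2:ℂ)⁻¹ • (1 - S) with hq'def
  have hq'def' : q' = (2:ℂ)⁻¹ • (1 + -S) := by rw [hq'def, sub_eq_add_neg]
  have hpp : p' * p' = p' := sp_half_one_add_mul_self hS2
  have hptp : p' * T' * p' = 0 := sp_half_one_add_mul_mul_half_one_add hS2 hST
  have htpt : T' * p' * T' = q' := sp_mul_half_one_add_mul hT2 hST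
  have hpq : p' + q' = 1 := sp_half_one_add_add_half_one_sub
  have htq : T' * q' = p' * T' := sp_mul_half_one_sub_eq hST
  have hqp : q' * p' = 0 := by
    rw [← htpt, mul_assoc, mul_assoc, ← mul_assoc p' T' p', hptp, mul_zero]
  have hpq0 : p' * q' = 0 := by
    have hq : q' = 1 - p' := by rw [← hpq, add_sub_cancel_left]
    rw [hq, mul_sub, mul_one, hpp, sub_self]
  have hp'adj : ∀ v w : complexBetti (⨁ (fun _ : Fin (n + 1) => A)).X 1, polarizationPairingOne (⨁ (fun _ : Fin (n + 1) => A)).X D ((⨁ (fun _ : Fin (n + 1) => A)).dim - 1) (p' v) w =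
      polarizationPairingOne (⨁ (fun _ : Fin (n + 1) => A)).X D ((⨁ (fun _ : Fin (n + 1) => A)).dim - 1) v (q' w) := by
    intro v w
    simp only [hp'def, hq'def, LinearMap.smul_apply, LinearMap.add_apply, LinearMap.sub_apply, Module.End.one_apply,
      map_add, map_sub, map_smul, LinearMap.smul_apply, hS_skew]
    rw [sub_eq_add_neg]
  let x' : Fin 2 → Module.End ℂ (complexBetti (⨁ (fun _ : Fin (n + 1) => A)).X 1) := ![p', T' * p']
  let y' : Fin 2 → Module.End ℂ (complexBetti (⨁ (fun _ : Fin (n + 1) => A)).X 1) := ![p', p' * T']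
  have hyx' : ∀ i j, y' i * x' j = if i = j then p' else 0 := by
    have h01 : p' * (T' * p') = 0 := by rw [← mul_assoc, hptp]
    have h11 : p' * T' * (T' * p') = p' := by rw [mul_assoc, ← mul_assoc T', hT2, one_mul, hpp]
    intro i j
    fin_cases i <;> fin_cases j <;> simp [x', y', hpp, h01, hptp, h11]
  have hsum' : ∑ i, x' i * y' i = 1 := by
    rw [Fin.sum_univ_two]
    change p' * p' + T' * p' * (p' * T') = 1
    rw [hpp, mul_assoc, ← mul_assoc p' p', hpp, ← mul_assoc, htpt, hpq]
  have ht'symm : ∀ v w : complexBetti (⨁ (fun _ : Fin (n + 1) => A)).X 1,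
      polarizationPairingOne (⨁ (fun _ : Fin (n + 1) => A)).X D ((⨁ (fun _ : Fin (n + 1) => A)).dim - 1) v (T' w) = polarizationPairingOne (⨁ (fun _ : Fin (n + 1) => A)).X D ((⨁ (fun _ : Fin (n + 1) => A)).dim - 1) w (T' v) := by
    intro v w
    rw [hQskew w (T' v), hT'_skew, neg_neg]
  have ht'nd : ∀ v ∈ LinearMap.range p',
      (∀ w ∈ LinearMap.range p', polarizationPairingOne (⨁ (fun _ : Fin (n + 1) => A)).X D ((⨁ (fun _ : Fin (n + 1) => A)).dim - 1) v (T' w) = 0) → v = 0 := by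
    intro v hv h0
    obtain ⟨v', rfl⟩ := hv
    refine hndX _ fun z ↦ ?_
    have hz : z = p' z + q' z := by rw [← LinearMap.add_apply, hpq, Module.End.one_apply]
    have h1 : polarizationPairingOne (⨁ (fun _ : Fin (n + 1) => A)).X D ((⨁ (fun _ : Fin (n + 1) => A)).dim - 1) (p' v') (p' z) = 0 := by
      rw [hp'adj, ← Module.End.mul_apply, hqp, LinearMap.zero_apply, map_zero]
    have h2 : polarizationPairingOne (⨁ (fun _ : Fin (n + 1) => A)).X D ((⨁ (fun _ : Fin (n + 1) => A)).dim - 1) (p' v') (q' z) = 0 := by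
      have e : q' z = T' (p' (T' z)) := by rw [← htpt]; rfl
      rw [e]
      exact h0 _ ⟨T' z, rfl⟩
    rw [hz, map_add, h1, h2, add_zero]
  -- commutation of the units and of `T` with the block
  have hcommS : ∀ L : Module.End ℂ (complexBetti (⨁ (fun _ : Fin (n + 1) => A)).X 1), L * S = S * L → L * T' = T' * L →
      L * p' = p' * L ∧ L * q' = q' * L ∧ (∀ k, L * x' k = x' k * L) ∧ (∀ k, L * y' k = y' k * L) := by
    intro L hLS hLT
    have hLp : L * p' = p' * L := sp_comm_half L hLS S (Or.inl rfl)
    have hLq : L * q' = q' * L := by rw [hq'def']; exact sp_comm_half L hLS (-S) (Or.inr rfl)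
    refine ⟨hLp, hLq, fun k ↦ ?_, fun k ↦ ?_⟩
    · fin_cases k
      · exact hLp
      · change L * (T' * p') = T' * p' * L
        rw [← mul_assoc, hLT, mul_assoc, hLp, ← mul_assoc]
    · fin_cases k
      · exact hLp
      · change L * (p' * T') = p' * T' * L
        rw [← mul_assoc, hLp, mul_assoc, hLT, ← mul_assoc]
  have hUx' : ∀ c d k, U c d * x' k = x' k * U c d := fun c d k ↦ (hcommS _ (hUS c d) (hUT' c d)).2.2.1 k
  have hUy' : ∀ c d k, U c d * y' k = y' k * U c d := fun c d k ↦ (hcommS _ (hUS c d) (hUT' c d)).2.2.2 k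
  have hUp' : ∀ c d, U c d * p' = p' * U c d := fun c d ↦ (hcommS _ (hUS c d) (hUT' c d)).1
  have hTx' : ∀ k, T * x' k = x' k * T := fun k ↦ (hcommS _ hTS hTT').2.2.1 k
  have hTy' : ∀ k, T * y' k = y' k * T := fun k ↦ (hcommS _ hTS hTT').2.2.2 k
  have hTp' : T * p' = p' * T := (hcommS _ hTS hTT').1
  -- `S, T'` lie in the span of the units
  have hST' : ({S, T'} : Set (Module.End ℂ (complexBetti (⨁ (fun _ : Fin (n + 1) => A)).X 1))) ⊆
      Submodule.span ℂ (Set.range fun ij : Fin 2 × Fin 2 ↦ x' ij.1 * y' ij.2) := by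
    have hSx : S = p' * p' - T' * p' * (p' * T') := by
      rw [hpp, mul_assoc, ← mul_assoc p' p', hpp, ← mul_assoc, htpt, hp'def, hq'def, sp_half_one_add_sub_half_one_sub]
    have hTx : T' = T' * p' * p' + p' * (p' * T') := by
      rw [mul_assoc T' p' p', hpp, ← mul_assoc p' p' T', hpp, hp'def, sp_eq_mul_half_one_add_add hST]
    refine Set.insert_subset_iff.2 ⟨?_, Set.singleton_subset_iff.2 ?_⟩
    · rw [hSx]
      exact Submodule.sub_mem _ (Submodule.subset_span ⟨(0, 0), rfl⟩) (Submodule.subset_span ⟨(1, 1), rfl⟩)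
    · rw [hTx]
      exact Submodule.add_mem _ (Submodule.subset_span ⟨(1, 0), rfl⟩) (Submodule.subset_span ⟨(0, 1), rfl⟩)
  have hp'𝔄 : p' ∈ 𝔄 := Subalgebra.smul_mem _ (Subalgebra.add_mem _ (Subalgebra.one_mem _) hS_mem) _
  have hx'𝔄 : ∀ k, x' k ∈ 𝔄 := by
    intro k
    fin_cases k
    · exact hp'𝔄
    · exact Subalgebra.mul_mem _ hT'_mem hp'𝔄
  have hy'𝔄 : ∀ k, y' k ∈ 𝔄 := by
    intro k
    fin_cases k
    · exact hp'𝔄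
    · exact Subalgebra.mul_mem _ hp'𝔄 hT'_mem
  -- the combined Morita datum over `Fin (n+1) × Fin 2`
  let x : Fin (n + 1) × Fin 2 → Module.End ℂ (complexBetti (⨁ (fun _ : Fin (n + 1) => A)).X 1) := fun ic ↦ U ic.1 0 * x' ic.2
  let y : Fin (n + 1) × Fin 2 → Module.End ℂ (complexBetti (⨁ (fun _ : Fin (n + 1) => A)).X 1) := fun ic ↦ y' ic.2 * U 0 ic.1
  let p : Module.End ℂ (complexBetti (⨁ (fun _ : Fin (n + 1) => A)).X 1) := U 0 0 * p'
  have hyx : ∀ ic jd, y ic * x jd = if ic = jd then p else 0 := by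
    rintro ⟨i, c⟩ ⟨j, d⟩
    change y' c * U 0 i * (U j 0 * x' d) = if (i, c) = (j, d) then U 0 0 * p' else 0
    rw [mul_assoc, ← mul_assoc (U 0 i), hU]
    by_cases hij : i = j
    · subst hij
      rw [if_pos rfl, hUx', ← mul_assoc, hyx']
      by_cases hcd : c = d
      · subst hcd
        rw [if_pos rfl, if_pos rfl]
        exact (comm_idem_of_moritaData hyx' hsum' (fun k ↦ hUx' 0 0 k) (fun k ↦ hUy' 0 0 k)).symm
      · rw [if_neg hcd, zero_mul, if_neg fun h ↦ hcd (Prod.mk.inj h).2]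
    · rw [if_neg hij, zero_mul, mul_zero, if_neg fun h ↦ hij (Prod.mk.inj h).1]
  have hsumxy : ∑ ic, x ic * y ic = 1 := by
    rw [Fintype.sum_prod_type]
    change ∑ i, ∑ c, U i 0 * x' c * (y' c * U 0 i) = 1
    have e1 : ∀ i c, U i 0 * x' c * (y' c * U 0 i) = U i 0 * (x' c * y' c) * U 0 i := fun i c ↦ by
      rw [mul_assoc, mul_assoc, mul_assoc]
    simp_rw [e1, ← Finset.sum_mul, ← Finset.mul_sum, hsum', mul_one, hU, if_true]
    exact hUsum
  have hxmem : ∀ ic, x ic ∈ 𝔄 := fun ic ↦ Subalgebra.mul_mem _ (hU𝔄 _ _) (hx'𝔄 _)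
  have hymem : ∀ ic, y ic ∈ 𝔄 := fun ic ↦ Subalgebra.mul_mem _ (hy'𝔄 _) (hU𝔄 _ _)
  have hTx : ∀ ic, T * x ic = x ic * T := by
    rintro ⟨i, c⟩
    change T * (U i 0 * x' c) = U i 0 * x' c * T
    rw [← mul_assoc, hTU, mul_assoc, hTx', ← mul_assoc]
  have hTy : ∀ ic, T * y ic = y ic * T := by
    rintro ⟨i, c⟩
    change T * (y' c * U 0 i) = y' c * U 0 i * T
    rw [← mul_assoc, hTy', mul_assoc, hTU, ← mul_assoc]
  -- non-degeneracy of `Q(·, t' ·)` on the corner `pV = e_{00} p' V ⊆ p'V`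
  have htnd : ∀ v ∈ LinearMap.range p,
      (∀ w ∈ LinearMap.range p, polarizationPairingOne (⨁ (fun _ : Fin (n + 1) => A)).X D ((⨁ (fun _ : Fin (n + 1) => A)).dim - 1) v (T' w) = 0) → v = 0 := by
    intro v hv h0
    obtain ⟨v', rfl⟩ := hv
    have hv1 : U 0 0 ((U 0 0 * p') v') = (U 0 0 * p') v' := by
      rw [← Module.End.mul_apply, ← mul_assoc, hU, if_pos rfl]
    refine ht'nd _ ⟨U 0 0 v', by rw [← Module.End.mul_apply, ← hUp']⟩ fun w hw ↦ ?_
    obtain ⟨w', rfl⟩ := hw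
    -- `Q(v, t' p' w') = Σ_a Q(v, t' e_{aa} p' w') = Q(v, t' e_{00} p' w') = 0`
    have hsplit : p' w' = ∑ a, U a a (p' w') := by rw [← LinearMap.sum_apply, hUsum, Module.End.one_apply]
    have hterm : ∀ a, a ≠ 0 →
        polarizationPairingOne (⨁ (fun _ : Fin (n + 1) => A)).X D ((⨁ (fun _ : Fin (n + 1) => A)).dim - 1) ((U 0 0 * p') v') (T' (U a a (p' w'))) = 0 := by
      intro a ha
      calc polarizationPairingOne (⨁ (fun _ : Fin (n + 1) => A)).X D ((⨁ (fun _ : Fin (n + 1) => A)).dim - 1) ((U 0 0 * p') v') (T' (U a a (p' w')))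
          = polarizationPairingOne (⨁ (fun _ : Fin (n + 1) => A)).X D ((⨁ (fun _ : Fin (n + 1) => A)).dim - 1) ((U 0 0 * p') v') (U a a (T' (p' w'))) := by
            rw [← Module.End.mul_apply T', ← hUT', Module.End.mul_apply (U a a) T']
        _ = polarizationPairingOne (⨁ (fun _ : Fin (n + 1) => A)).X D ((⨁ (fun _ : Fin (n + 1) => A)).dim - 1) (U a a ((U 0 0 * p') v')) (T' (p' w')) := by rw [hUadj]
        _ = 0 := by
            rw [← hv1, ← Module.End.mul_apply (U a a), hU, if_neg ha, LinearMap.zero_apply,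
              LinearMap.map_zero₂]
    rw [hsplit, map_sum, map_sum, Finset.sum_eq_single (0 : Fin (n + 1)) (fun a _ ha ↦ hterm a ha)
      fun h0' ↦ absurd (Finset.mem_univ _) h0']
    exact h0 _ ⟨w', by rw [Module.End.mul_apply]⟩
  -- the generators lie in `ℂ⟨T, x y⟩`
  have hW_unit : ∀ c d, U c d ∈ Submodule.span ℂ
      (Set.range fun st : (Fin (n + 1) × Fin 2) × (Fin (n + 1) × Fin 2) ↦ x st.1 * y st.2) := by
    intro c d
    have e1 : U c d = ∑ k, x (c, k) * y (d, k) := by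
      change U c d = ∑ k, U c 0 * x' k * (y' k * U 0 d)
      have e2 : ∀ k, U c 0 * x' k * (y' k * U 0 d) = U c 0 * (x' k * y' k) * U 0 d := fun k ↦ by
        rw [mul_assoc, mul_assoc, mul_assoc]
      simp_rw [e2, ← Finset.sum_mul, ← Finset.mul_sum, hsum', mul_one, hU, if_true]
    rw [e1]
    exact Submodule.sum_mem _ fun k _ ↦ Submodule.subset_span ⟨((c, k), (d, k)), rfl⟩
  have hW_pair : ∀ k l, x' k * y' l ∈ Submodule.span ℂ
      (Set.range fun st : (Fin (n + 1) × Fin 2) × (Fin (n + 1) × Fin 2) ↦ x st.1 * y st.2) := by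
    intro k l
    have e1 : x' k * y' l = ∑ i, x (i, k) * y (i, l) := by
      change x' k * y' l = ∑ i, U i 0 * x' k * (y' l * U 0 i)
      have e2 : ∀ i, U i 0 * x' k * (y' l * U 0 i) = x' k * y' l * (U i 0 * U 0 i) := fun i ↦ by
        rw [hUx', mul_assoc, mul_assoc, ← mul_assoc (U i 0), hUy', mul_assoc]
      simp_rw [e2, hU, if_true, ← Finset.mul_sum, hUsum, mul_one]
    rw [e1]
    exact Submodule.sum_mem _ fun i _ ↦ Submodule.subset_span ⟨((i, k), (i, l)), rfl⟩
  have hSa_eq : Sa = S * Ra' := by rw [hSdef, mul_assoc, hRaRa', mul_one]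
  have hSb_eq : Sb = T' * Rb' := by rw [hT'def, mul_assoc, hRbRb', mul_one]
  have hgens : insert T (insert Sa (insert Sb (Set.range fun ab : Fin (n + 1) × Fin (n + 1) ↦ U ab.1 ab.2))) ⊆
      (Algebra.adjoin ℂ (insert T (Set.range fun st : (Fin (n + 1) × Fin 2) × (Fin (n + 1) × Fin 2) ↦
        x st.1 * y st.2)) : Set (Module.End ℂ (complexBetti (⨁ (fun _ : Fin (n + 1) => A)).X 1))) := by
    have hWR : Submodule.span ℂ (Set.range fun st : (Fin (n + 1) × Fin 2) × (Fin (n + 1) × Fin 2) ↦ x st.1 * y st.2) ≤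
        Subalgebra.toSubmodule (Algebra.adjoin ℂ (insert T (Set.range
          fun st : (Fin (n + 1) × Fin 2) × (Fin (n + 1) × Fin 2) ↦ x st.1 * y st.2))) :=
      Submodule.span_le.2 fun g hg ↦ Algebra.subset_adjoin (Set.mem_insert_of_mem _ hg)
    have hSW : ({S, T'} : Set (Module.End ℂ (complexBetti (⨁ (fun _ : Fin (n + 1) => A)).X 1))) ⊆ Submodule.span ℂ
        (Set.range fun st : (Fin (n + 1) × Fin 2) × (Fin (n + 1) × Fin 2) ↦ x st.1 * y st.2) :=
      hST'.trans (Submodule.span_le.2 (by rintro _ ⟨kl, rfl⟩; exact hW_pair kl.1 kl.2))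
    have hPT : ∀ q : ℂ[X], aeval T q ∈ Algebra.adjoin ℂ (insert T (Set.range
        fun st : (Fin (n + 1) × Fin 2) × (Fin (n + 1) × Fin 2) ↦ x st.1 * y st.2)) :=
      fun q ↦ Algebra.adjoin_mono (Set.singleton_subset_iff.2 (Set.mem_insert _ _))
        (Polynomial.aeval_mem_adjoin_singleton ℂ T)
    refine Set.insert_subset_iff.2 ⟨Algebra.subset_adjoin (Set.mem_insert _ _), Set.insert_subset_iff.2
      ⟨?_, Set.insert_subset_iff.2 ⟨?_, ?_⟩⟩⟩
    · rw [hSa_eq, hRa'def]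
      exact Subalgebra.mul_mem _ (hWR (hSW (Set.mem_insert _ _))) (hPT _)
    · rw [hSb_eq, hRb'def]
      exact Subalgebra.mul_mem _ (hWR (hSW (Set.mem_insert_of_mem _ (Set.mem_singleton _)))) (hPT _)
    · rintro _ ⟨ab, rfl⟩
      exact hWR (hW_unit ab.1 ab.2)
  -- THE EXPONENTS: `2 · dim(pV ∩ ker(T - z)) = dim ker(ψ^* - z)` at every place `z`
  have hTp : T * p = p * T := by
    change T * (U 0 0 * p') = U 0 0 * p' * T
    rw [← mul_assoc, hTU, mul_assoc, hTp', ← mul_assoc]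
  have hcorner : ∀ z ∈ s, 2 * Module.finrank ℂ ↥(LinearMap.range p ⊓ T.eigenspace z) =
      Module.finrank ℂ ↥((pullbackOne A ψ).eigenspace z) := by
    intro z hz
    have hPzU : aeval T (Lagrange.basis s id z) * U 0 0 = U 0 0 * aeval T (Lagrange.basis s id z) :=
      aeval_comm_of_comm T (U 0 0) (hTU 0 0) _
    have hPzp' : aeval T (Lagrange.basis s id z) * p' = p' * aeval T (Lagrange.basis s id z) :=
      aeval_comm_of_comm T p' hTp' _
    have hPzT' : aeval T (Lagrange.basis s id z) * T' = T' * aeval T (Lagrange.basis s id z) :=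
      aeval_comm_of_comm T T' hTT' _
    -- the corner and the slot as ranges of `(P_z e_{00}) p'` and `P_z e_{00}`
    have h1 : LinearMap.range p ⊓ T.eigenspace z = LinearMap.range (aeval T (Lagrange.basis s id z) * U 0 0 * p') := by
      rw [mul_assoc]
      exact (range_aeval_lagrange_basis_mul_eq_of_comm hsne hTnodal hTp hz).symm
    have h2 : LinearMap.range (aeval T (Lagrange.basis s id z) * U 0 0) = LinearMap.range (U 0 0) ⊓ T.eigenspace z :=
      range_aeval_lagrange_basis_mul_eq_of_comm hsne hTnodal (hTU 0 0) hz
    -- `2 dim((P_z e_{00}) p' V) = dim(P_z e_{00} V)`: `T'` exchanges the corners `p'V`, `q'V`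
    have hep : aeval T (Lagrange.basis s id z) * U 0 0 * p' = p' * (aeval T (Lagrange.basis s id z) * U 0 0) := by
      rw [mul_assoc, hUp', ← mul_assoc, hPzp', mul_assoc]
    have het : aeval T (Lagrange.basis s id z) * U 0 0 * T' = T' * (aeval T (Lagrange.basis s id z) * U 0 0) := by
      rw [mul_assoc, hUT', ← mul_assoc, hPzT', mul_assoc]
    rw [h1, two_mul_finrank_range_mul_eq_finrank_range hpq hqp hpq0 hT2 htpt hep het, h2]
    exact finrank_range_π_comp_ι_inf_eigenspace_biproductMap_eq ψ 0 z
  -- the parity hypothesis, transported: `dim(V_ρ ∩ ker(T - z)) = j · dim ker(ψ^* - z) = 2 j · dim(pV ∩ ker(T - z))`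
  have heven : ∀ ρ : ℂ, Polynomial.eval₂ (Int.castRingHom ℂ) ρ P = 0 → ∀ z ∈ s, ∃ j : ℕ,
      Module.finrank ℂ ↥((pullbackOne (⨁ (fun _ : Fin (n + 1) => A)) φ).eigenspace ρ ⊓ T.eigenspace z) =
        2 * j * Module.finrank ℂ ↥(LinearMap.range p ⊓ T.eigenspace z) := by
    intro ρ hρ z hz
    obtain ⟨j, hj⟩ := hdvd ρ hρ z (hmem_s z hz)
    refine ⟨j, ?_⟩
    rw [mul_comm 2 j, mul_assoc, hcorner z hz, mul_comm]
    exact hj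
  exact weilClassesField_le_divisorClassesSpan_of_moritaData_of_cornerForm_of_symmetric_of_even hPm hPe hPirr hφ herX
    hhX hndX hyx hsumxy hxmem hymem hT'_mem ht'symm htnd hT𝔄 hT_symm.2 hTx hTy hTT' hsne hTnodal
    (Algebra.adjoin_le hgens hF) heven


/-- **… and consists of HODGE classes** (`W_F ⊗ ℂ ≤ ℬᵐ ⊗ ℂ`; automatic for type 3 in the print, «if `X` is of type 1, 2
or 3, then the spaces `W_F` … always consist of Hodge classes», a consequence here).
[cite: MoonenZarhin1998WeilClasses, §1 Criterion (2) and Remark (1) after it (chunk p0003 L46–L60, p0004 L36–L40)]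
[cite: vanGeemen1994HodgeAV, §2.4] -/
theorem weilClassesField_biproduct_le_hodgeClassSpan_of_mem_adjoin_definiteQuaternionOver_diagonal_of_dvd
    (hA : 0 < A.dim) (hh : h ∈ hodgeClassSpan A.dim A.X 1) (htop : lefschetzPow h (A.dim - 1) 2 h ≠ 0)
    (hnd : ∀ x : complexBetti A.X 1, (∀ y, polarizationPairingOne A.X h (A.dim - 1) x y = 0) → x = 0)
    (hψsym : ∀ v w : complexBetti A.X 1, polarizationPairingOne A.X h (A.dim - 1) (pullbackOne A ψ v) w =
      polarizationPairingOne A.X h (A.dim - 1) v (pullbackOne A ψ w))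
    (hQm : Q.Monic) (hQirr : Irreducible (Q.map (Int.castRingHom ℚ)))
    (hψQ : Polynomial.eval₂ (Int.castRingHom (CategoryTheory.End A)) (ψ : CategoryTheory.End A) Q = 0)
    (hα2 : pullbackOne A α * pullbackOne A α = aeval (pullbackOne A ψ) qa)
    (hqa : ∀ z : ℂ, (Q.map (Int.castRingHom ℂ)).IsRoot z → qa.eval z ≠ 0)
    (hβ2 : pullbackOne A β * pullbackOne A β = aeval (pullbackOne A ψ) qb)
    (hqb : ∀ z : ℂ, (Q.map (Int.castRingHom ℂ)).IsRoot z → qb.eval z ≠ 0)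
    (hanti : pullbackOne A α * pullbackOne A β = -(pullbackOne A β * pullbackOne A α))
    (hαskew : ∀ v w : complexBetti A.X 1, polarizationPairingOne A.X h (A.dim - 1) (pullbackOne A α v) w =
      -polarizationPairingOne A.X h (A.dim - 1) v (pullbackOne A α w))
    (hβskew : ∀ v w : complexBetti A.X 1, polarizationPairingOne A.X h (A.dim - 1) (pullbackOne A β v) w =
      -polarizationPairingOne A.X h (A.dim - 1) v (pullbackOne A β w))
    (hψα : pullbackOne A ψ * pullbackOne A α = pullbackOne A α * pullbackOne A ψ)
    (hψβ : pullbackOne A ψ * pullbackOne A β = pullbackOne A β * pullbackOne A ψ)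
    (hPm : P.Monic) (hPe : P.natDegree = e) (hPirr : Irreducible (P.map (Int.castRingHom ℚ)))
    (hφ : Polynomial.eval₂ (Int.castRingHom (CategoryTheory.End (⨁ (fun _ : Fin (n + 1) => A))))
      (φ : CategoryTheory.End (⨁ (fun _ : Fin (n + 1) => A))) P = 0)
    (her : e * (2 * m) = 2 * ((n + 1) * A.dim))
    (hF : pullbackOne (⨁ (fun _ : Fin (n + 1) => A)) φ ∈ Algebra.adjoin ℂ
      (insert (pullbackOne (⨁ (fun _ : Fin (n + 1) => A)) (biproduct.map fun _ : Fin (n + 1) => ψ))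
        (insert (pullbackOne (⨁ (fun _ : Fin (n + 1) => A)) (biproduct.map fun _ : Fin (n + 1) => α))
          (insert (pullbackOne (⨁ (fun _ : Fin (n + 1) => A)) (biproduct.map fun _ : Fin (n + 1) => β))
            (Set.range fun ab : Fin (n + 1) × Fin (n + 1) ↦ pullbackOne (⨁ (fun _ : Fin (n + 1) => A))
              (biproduct.π (fun _ : Fin (n + 1) => A) ab.1 ≫ biproduct.ι (fun _ : Fin (n + 1) => A) ab.2))))))
    (hdvd : ∀ ρ : ℂ, Polynomial.eval₂ (Int.castRingHom ℂ) ρ P = 0 → ∀ z : ℂ, (Q.map (Int.castRingHom ℂ)).IsRoot z →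
      Module.finrank ℂ ↥((pullbackOne A ψ).eigenspace z) ∣
        Module.finrank ℂ ↥((pullbackOne (⨁ (fun _ : Fin (n + 1) => A)) φ).eigenspace ρ ⊓
          (pullbackOne (⨁ (fun _ : Fin (n + 1) => A)) (biproduct.map fun _ : Fin (n + 1) => ψ)).eigenspace z)) :
    weilClassesField (⨁ (fun _ : Fin (n + 1) => A)) φ P (2 * m) ≤
      hodgeClassSpan (⨁ (fun _ : Fin (n + 1) => A)).dim (⨁ (fun _ : Fin (n + 1) => A)).X m :=
  (weilClassesField_biproduct_le_divisorClassesSpan_of_mem_adjoin_definiteQuaternionOver_diagonal_of_dvd hA hh htop hnd hψsym hQm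
      hQirr hψQ hα2 hqa hβ2 hqb hanti hαskew hβskew hψα hψβ hPm hPe hPirr hφ her hF hdvd).trans
    (divisorClassesSpan_le_hodgeClassSpan_of_isSmoothProjective
      (AbelianVariety.isSmoothProjective_holds (A := (⨁ (fun _ : Fin (n + 1) => A)))) m)

/-- **… and is ALGEBRAIC**: `W_F ⊗ ℂ ≤ algebraicClasses` — the Weil classes of `F ⊆ M_{n+1}(D)`, `D` a definite
quaternion algebra over the real-multiplication field `ℚ(ψ)` presented by a Rosati-skew anticommuting pair, on `A^{n+1}`,
are algebraic whenever every per-place exponent is even, by the Lefschetz theorem on `(1,1)`-classes (the tree's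
`lefschetzOneOne_rational_holds`). [cite: MoonenZarhin1998WeilClasses, Introduction (chunk p0001 L10–L18) and §1 Criterion (2) (chunk p0003 L46–L111)]
[cite: VoisinHodgeI2002, Thm. 11.30] -/
theorem weilClassesField_biproduct_le_algebraicClasses_of_mem_adjoin_definiteQuaternionOver_diagonal_of_dvd
    (hA : 0 < A.dim) (hh : h ∈ hodgeClassSpan A.dim A.X 1) (htop : lefschetzPow h (A.dim - 1) 2 h ≠ 0)
    (hnd : ∀ x : complexBetti A.X 1, (∀ y, polarizationPairingOne A.X h (A.dim - 1) x y = 0) → x = 0)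
    (hψsym : ∀ v w : complexBetti A.X 1, polarizationPairingOne A.X h (A.dim - 1) (pullbackOne A ψ v) w =
      polarizationPairingOne A.X h (A.dim - 1) v (pullbackOne A ψ w))
    (hQm : Q.Monic) (hQirr : Irreducible (Q.map (Int.castRingHom ℚ)))
    (hψQ : Polynomial.eval₂ (Int.castRingHom (CategoryTheory.End A)) (ψ : CategoryTheory.End A) Q = 0)
    (hα2 : pullbackOne A α * pullbackOne A α = aeval (pullbackOne A ψ) qa)
    (hqa : ∀ z : ℂ, (Q.map (Int.castRingHom ℂ)).IsRoot z → qa.eval z ≠ 0)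
    (hβ2 : pullbackOne A β * pullbackOne A β = aeval (pullbackOne A ψ) qb)
    (hqb : ∀ z : ℂ, (Q.map (Int.castRingHom ℂ)).IsRoot z → qb.eval z ≠ 0)
    (hanti : pullbackOne A α * pullbackOne A β = -(pullbackOne A β * pullbackOne A α))
    (hαskew : ∀ v w : complexBetti A.X 1, polarizationPairingOne A.X h (A.dim - 1) (pullbackOne A α v) w =
      -polarizationPairingOne A.X h (A.dim - 1) v (pullbackOne A α w))
    (hβskew : ∀ v w : complexBetti A.X 1, polarizationPairingOne A.X h (A.dim - 1) (pullbackOne A β v) w =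
      -polarizationPairingOne A.X h (A.dim - 1) v (pullbackOne A β w))
    (hψα : pullbackOne A ψ * pullbackOne A α = pullbackOne A α * pullbackOne A ψ)
    (hψβ : pullbackOne A ψ * pullbackOne A β = pullbackOne A β * pullbackOne A ψ)
    (hPm : P.Monic) (hPe : P.natDegree = e) (hPirr : Irreducible (P.map (Int.castRingHom ℚ)))
    (hφ : Polynomial.eval₂ (Int.castRingHom (CategoryTheory.End (⨁ (fun _ : Fin (n + 1) => A))))
      (φ : CategoryTheory.End (⨁ (fun _ : Fin (n + 1) => A))) P = 0)
    (her : e * (2 * m) = 2 * ((n + 1) * A.dim))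
    (hF : pullbackOne (⨁ (fun _ : Fin (n + 1) => A)) φ ∈ Algebra.adjoin ℂ
      (insert (pullbackOne (⨁ (fun _ : Fin (n + 1) => A)) (biproduct.map fun _ : Fin (n + 1) => ψ))
        (insert (pullbackOne (⨁ (fun _ : Fin (n + 1) => A)) (biproduct.map fun _ : Fin (n + 1) => α))
          (insert (pullbackOne (⨁ (fun _ : Fin (n + 1) => A)) (biproduct.map fun _ : Fin (n + 1) => β))
            (Set.range fun ab : Fin (n + 1) × Fin (n + 1) ↦ pullbackOne (⨁ (fun _ : Fin (n + 1) => A))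
              (biproduct.π (fun _ : Fin (n + 1) => A) ab.1 ≫ biproduct.ι (fun _ : Fin (n + 1) => A) ab.2))))))
    (hdvd : ∀ ρ : ℂ, Polynomial.eval₂ (Int.castRingHom ℂ) ρ P = 0 → ∀ z : ℂ, (Q.map (Int.castRingHom ℂ)).IsRoot z →
      Module.finrank ℂ ↥((pullbackOne A ψ).eigenspace z) ∣
        Module.finrank ℂ ↥((pullbackOne (⨁ (fun _ : Fin (n + 1) => A)) φ).eigenspace ρ ⊓
          (pullbackOne (⨁ (fun _ : Fin (n + 1) => A)) (biproduct.map fun _ : Fin (n + 1) => ψ)).eigenspace z)) :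
    weilClassesField (⨁ (fun _ : Fin (n + 1) => A)) φ P (2 * m) ≤ algebraicClasses (⨁ (fun _ : Fin (n + 1) => A)).X m :=
  (weilClassesField_biproduct_le_divisorClassesSpan_of_mem_adjoin_definiteQuaternionOver_diagonal_of_dvd hA hh htop hnd hψsym hQm
      hQirr hψQ hα2 hqa hβ2 hqb hanti hαskew hβskew hψα hψβ hPm hPe hPirr hφ her hF hdvd).trans
    (AbelianVariety.divisorClassesSpan_le_algebraicClasses (⨁ (fun _ : Fin (n + 1) => A))
      (fun c hc hc' ↦ lefschetzOneOne_rational_holds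
        (AbelianVariety.isSmoothProjective_holds (A := (⨁ (fun _ : Fin (n + 1) => A)))) c hc hc') m)

/-- Element form: every class of `W_F ⊗ ℂ` is a `ℂ`-combination of algebraic classes.
[cite: MoonenZarhin1998WeilClasses, Introduction (chunk p0001 L10–L18) and §1 Criterion (2) (chunk p0003 L46–L111)] -/
theorem mem_algebraicClasses_of_mem_weilClassesField_biproduct_of_mem_adjoin_definiteQuaternionOver_diagonal_of_dvd
    (hA : 0 < A.dim) (hh : h ∈ hodgeClassSpan A.dim A.X 1) (htop : lefschetzPow h (A.dim - 1) 2 h ≠ 0)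
    (hnd : ∀ x : complexBetti A.X 1, (∀ y, polarizationPairingOne A.X h (A.dim - 1) x y = 0) → x = 0)
    (hψsym : ∀ v w : complexBetti A.X 1, polarizationPairingOne A.X h (A.dim - 1) (pullbackOne A ψ v) w =
      polarizationPairingOne A.X h (A.dim - 1) v (pullbackOne A ψ w))
    (hQm : Q.Monic) (hQirr : Irreducible (Q.map (Int.castRingHom ℚ)))
    (hψQ : Polynomial.eval₂ (Int.castRingHom (CategoryTheory.End A)) (ψ : CategoryTheory.End A) Q = 0)
    (hα2 : pullbackOne A α * pullbackOne A α = aeval (pullbackOne A ψ) qa)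
    (hqa : ∀ z : ℂ, (Q.map (Int.castRingHom ℂ)).IsRoot z → qa.eval z ≠ 0)
    (hβ2 : pullbackOne A β * pullbackOne A β = aeval (pullbackOne A ψ) qb)
    (hqb : ∀ z : ℂ, (Q.map (Int.castRingHom ℂ)).IsRoot z → qb.eval z ≠ 0)
    (hanti : pullbackOne A α * pullbackOne A β = -(pullbackOne A β * pullbackOne A α))
    (hαskew : ∀ v w : complexBetti A.X 1, polarizationPairingOne A.X h (A.dim - 1) (pullbackOne A α v) w =
      -polarizationPairingOne A.X h (A.dim - 1) v (pullbackOne A α w))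
    (hβskew : ∀ v w : complexBetti A.X 1, polarizationPairingOne A.X h (A.dim - 1) (pullbackOne A β v) w =
      -polarizationPairingOne A.X h (A.dim - 1) v (pullbackOne A β w))
    (hψα : pullbackOne A ψ * pullbackOne A α = pullbackOne A α * pullbackOne A ψ)
    (hψβ : pullbackOne A ψ * pullbackOne A β = pullbackOne A β * pullbackOne A ψ)
    (hPm : P.Monic) (hPe : P.natDegree = e) (hPirr : Irreducible (P.map (Int.castRingHom ℚ)))
    (hφ : Polynomial.eval₂ (Int.castRingHom (CategoryTheory.End (⨁ (fun _ : Fin (n + 1) => A))))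
      (φ : CategoryTheory.End (⨁ (fun _ : Fin (n + 1) => A))) P = 0)
    (her : e * (2 * m) = 2 * ((n + 1) * A.dim))
    (hF : pullbackOne (⨁ (fun _ : Fin (n + 1) => A)) φ ∈ Algebra.adjoin ℂ
      (insert (pullbackOne (⨁ (fun _ : Fin (n + 1) => A)) (biproduct.map fun _ : Fin (n + 1) => ψ))
        (insert (pullbackOne (⨁ (fun _ : Fin (n + 1) => A)) (biproduct.map fun _ : Fin (n + 1) => α))
          (insert (pullbackOne (⨁ (fun _ : Fin (n + 1) => A)) (biproduct.map fun _ : Fin (n + 1) => β))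
            (Set.range fun ab : Fin (n + 1) × Fin (n + 1) ↦ pullbackOne (⨁ (fun _ : Fin (n + 1) => A))
              (biproduct.π (fun _ : Fin (n + 1) => A) ab.1 ≫ biproduct.ι (fun _ : Fin (n + 1) => A) ab.2))))))
    (hdvd : ∀ ρ : ℂ, Polynomial.eval₂ (Int.castRingHom ℂ) ρ P = 0 → ∀ z : ℂ, (Q.map (Int.castRingHom ℂ)).IsRoot z →
      Module.finrank ℂ ↥((pullbackOne A ψ).eigenspace z) ∣
        Module.finrank ℂ ↥((pullbackOne (⨁ (fun _ : Fin (n + 1) => A)) φ).eigenspace ρ ⊓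
          (pullbackOne (⨁ (fun _ : Fin (n + 1) => A)) (biproduct.map fun _ : Fin (n + 1) => ψ)).eigenspace z))
    {c : complexBetti (⨁ (fun _ : Fin (n + 1) => A)).X (2 * m)}
    (hc : c ∈ weilClassesField (⨁ (fun _ : Fin (n + 1) => A)) φ P (2 * m)) :
    c ∈ algebraicClasses (⨁ (fun _ : Fin (n + 1) => A)).X m :=
  weilClassesField_biproduct_le_algebraicClasses_of_mem_adjoin_definiteQuaternionOver_diagonal_of_dvd hA hh htop hnd hψsym hQm
      hQirr hψQ hα2 hqa hβ2 hqb hanti hαskew hβskew hψα hψβ hPm hPe hPirr hφ her hF hdvd hc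

end DefiniteQuaternionMatrices

/-! ### §5 Centre `ℚ` (`e₀ = 1`): `D = ℚ⟨α, β⟩` definite, `F ⊆ M_{n+1}(D)` — decomposable as soon as `dim A ∣ m`,
i.e. `[F:ℚ] ∣ n + 1`; the print's «`2m/[F:ℚ]` even» (`m = n + 1`) for `Y` of type 3 with centre `ℚ` -/

section DefiniteQuaternionOverRat

variable {A : AbelianVariety ℂ} {h : complexBetti A.X 2} {n : ℕ} {α β : A ⟶ A} {a b : ℂ}
  {φ : ⨁ (fun _ : Fin (n + 1) => A) ⟶ ⨁ (fun _ : Fin (n + 1) => A)} {P : Polynomial ℤ} {e m : ℕ}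

/-- **TYPE 3 OVER `ℚ` ON POWERS — `W_F(A^{n+1})` IS DECOMPOSABLE FOR `F ⊆ M_{n+1}(ℚ⟨α, β⟩)` WHENEVER `dim A ∣ m`.**
Let `A` be a complex abelian variety of positive dimension with `h ∈ B¹(A) ⊗ ℂ`, `h^{dim A} ≠ 0`, `Q_h` non-degenerate;
`α, β ∈ End(A)` ROSATI-SKEW, anticommuting, with `α^{*2} = a`, `β^{*2} = b` non-zero scalars (`D = ℚ⟨α, β⟩` a definite
quaternion algebra over `ℚ` so presented); `φ ∈ End(A^{n+1})` with `φ^* ∈ ℂ⟨(⊕α)^*, (⊕β)^*, (πₐ ≫ ι_b)^*⟩` — `F = ℚ(φ) ⊆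
M_{n+1}(D)` — `P(φ) = 0`, `P` monic irreducible of degree `e`, `e · 2m = 2(n+1) dim A` (so `dim V_ρ = 2m` at every root
`ρ`).  If `dim A ∣ m` — equivalently `[F:ℚ] ∣ n + 1`; the single exponent `l(ρ) = 2m / dim A` is even, which for `A`
simple of type 3 with `End⁰(A) = D` is the print's «`2m′/[F:ℚ]` even», `m′ = n + 1` — then `W_F ⊗ ℂ ≤ 𝒟ᵐ ⊗ ℂ` for the
product polarization (§4 with `ψ = 𝟙`, `Q = T - 1`, one place `z = 1`, `ker(𝟙^* - 1) = H¹(A)`).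
[cite: MoonenZarhin1998WeilClasses, §1 Criterion (2), case «Type 3, m ≥ 2, 2m·[E:ℚ]/[F:ℚ]» with E = ℚ, and its proof (chunk p0003 L46–L60, L92–L111)]
[cite: Milne1999LefschetzClasses, §1 p. 643, Thm. 3.2, Cor. 4.5] -/
theorem weilClassesField_biproduct_le_divisorClassesSpan_of_mem_adjoin_definiteQuaternion_diagonal_of_dvd
    (hA : 0 < A.dim) (hh : h ∈ hodgeClassSpan A.dim A.X 1) (htop : lefschetzPow h (A.dim - 1) 2 h ≠ 0)
    (hnd : ∀ x : complexBetti A.X 1, (∀ y, polarizationPairingOne A.X h (A.dim - 1) x y = 0) → x = 0)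
    (ha : a ≠ 0) (hα2 : pullbackOne A α * pullbackOne A α = a • 1)
    (hb : b ≠ 0) (hβ2 : pullbackOne A β * pullbackOne A β = b • 1)
    (hanti : pullbackOne A α * pullbackOne A β = -(pullbackOne A β * pullbackOne A α))
    (hαskew : ∀ v w : complexBetti A.X 1, polarizationPairingOne A.X h (A.dim - 1) (pullbackOne A α v) w =
      -polarizationPairingOne A.X h (A.dim - 1) v (pullbackOne A α w))
    (hβskew : ∀ v w : complexBetti A.X 1, polarizationPairingOne A.X h (A.dim - 1) (pullbackOne A β v) w =
      -polarizationPairingOne A.X h (A.dim - 1) v (pullbackOne A β w))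
    (hPm : P.Monic) (hPe : P.natDegree = e) (hPirr : Irreducible (P.map (Int.castRingHom ℚ)))
    (hφ : Polynomial.eval₂ (Int.castRingHom (CategoryTheory.End (⨁ (fun _ : Fin (n + 1) => A))))
      (φ : CategoryTheory.End (⨁ (fun _ : Fin (n + 1) => A))) P = 0)
    (her : e * (2 * m) = 2 * ((n + 1) * A.dim))
    (hF : pullbackOne (⨁ (fun _ : Fin (n + 1) => A)) φ ∈ Algebra.adjoin ℂ
      (insert (pullbackOne (⨁ (fun _ : Fin (n + 1) => A)) (biproduct.map fun _ : Fin (n + 1) => α))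
        (insert (pullbackOne (⨁ (fun _ : Fin (n + 1) => A)) (biproduct.map fun _ : Fin (n + 1) => β))
          (Set.range fun ab : Fin (n + 1) × Fin (n + 1) ↦ pullbackOne (⨁ (fun _ : Fin (n + 1) => A))
            (biproduct.π (fun _ : Fin (n + 1) => A) ab.1 ≫ biproduct.ι (fun _ : Fin (n + 1) => A) ab.2)))))
    (hdvd : A.dim ∣ m) :
    weilClassesField (⨁ (fun _ : Fin (n + 1) => A)) φ P (2 * m) ≤
      divisorClassesSpan (⨁ (fun _ : Fin (n + 1) => A)).X (⨁ (fun _ : Fin (n + 1) => A)).dim m := by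
  classical
  have herX : e * (2 * m) = 2 * (⨁ (fun _ : Fin (n + 1) => A)).dim := by rw [dim_biproduct_const_succ A n, her]
  have h1 : pullbackOne A (𝟙 A) = 1 := pullbackOne_id_eq_one
  have hT1 : pullbackOne (⨁ (fun _ : Fin (n + 1) => A)) (biproduct.map fun _ : Fin (n + 1) => 𝟙 A) = 1 := by
    have e1 : (biproduct.map fun _ : Fin (n + 1) => 𝟙 A) = 𝟙 (⨁ (fun _ : Fin (n + 1) => A)) :=
      biproduct.hom_ext _ _ fun j ↦ by rw [biproduct.map_π, Category.comp_id, Category.id_comp]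
    rw [e1, pullbackOne_id_eq_one]
  have hQm : (Polynomial.X - Polynomial.C (1 : ℤ)).Monic := Polynomial.monic_X_sub_C 1
  have hQirr : Irreducible ((Polynomial.X - Polynomial.C (1 : ℤ)).map (Int.castRingHom ℚ)) := by
    rw [Polynomial.map_sub, Polynomial.map_X, Polynomial.map_C, map_one]
    exact Polynomial.irreducible_X_sub_C 1
  have hroot : ∀ z : ℂ, ((Polynomial.X - Polynomial.C (1 : ℤ)).map (Int.castRingHom ℂ)).IsRoot z → z = 1 := by
    intro z hz
    rw [Polynomial.map_sub, Polynomial.map_X, Polynomial.map_C, map_one, Polynomial.IsRoot.def, Polynomial.eval_sub,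
      Polynomial.eval_X, Polynomial.eval_C, sub_eq_zero] at hz
    exact hz
  refine weilClassesField_biproduct_le_divisorClassesSpan_of_mem_adjoin_definiteQuaternionOver_diagonal_of_dvd
    (ψ := 𝟙 A) (Q := Polynomial.X - Polynomial.C 1) (qa := Polynomial.C a) (qb := Polynomial.C b) hA hh htop hnd
    (fun v w ↦ by rw [h1, Module.End.one_apply, Module.End.one_apply]) hQm hQirr ?_ ?_ (fun z _ ↦ by rwa [Polynomial.eval_C])
    ?_ (fun z _ ↦ by rwa [Polynomial.eval_C]) hanti hαskew hβskew (by rw [h1, one_mul, mul_one])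
    (by rw [h1, one_mul, mul_one]) hPm hPe hPirr hφ her (Algebra.adjoin_mono (Set.subset_insert _ _) hF) fun ρ hρ z hz ↦ ?_
  · rw [Polynomial.eval₂_sub, Polynomial.eval₂_X, Polynomial.eval₂_C, map_one]
    exact sub_self _
  · rw [h1, Polynomial.aeval_C, Algebra.algebraMap_eq_smul_one]
    exact hα2
  · rw [h1, Polynomial.aeval_C, Algebra.algebraMap_eq_smul_one]
    exact hβ2
  · -- one place `z = 1`: `ker(𝟙^* - 1) = H¹(A)` and `ker((⊕𝟙)^* - 1) = H¹(X)`, `dim V_ρ = 2m`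
    obtain rfl := hroot z hz
    have htopA : (pullbackOne A (𝟙 A)).eigenspace 1 = ⊤ := by
      rw [eq_top_iff]
      intro v _
      rw [Module.End.mem_eigenspace_iff, h1, Module.End.one_apply, one_smul]
    have htopX : (pullbackOne (⨁ (fun _ : Fin (n + 1) => A)) (biproduct.map fun _ : Fin (n + 1) => 𝟙 A)).eigenspace 1 = ⊤ := by
      rw [eq_top_iff]
      intro v _
      rw [Module.End.mem_eigenspace_iff, hT1, Module.End.one_apply, one_smul]
    rw [htopA, htopX, inf_top_eq, finrank_top, AbelianVariety.finrank_complexBetti_one,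
      finrank_eigenspace_eq_of_root hPm hPe hPirr hφ herX hρ]
    exact Nat.mul_dvd_mul_left 2 hdvd

/-- **… and is ALGEBRAIC** (`W_F ⊗ ℂ ≤ algebraicClasses`, Lefschetz `(1,1)`): type 3 over `ℚ` on powers with `dim A ∣ m`.
[cite: MoonenZarhin1998WeilClasses, Introduction and §1 Criterion (2) (chunk p0001 L10–L18, p0003 L46–L111)]
[cite: VoisinHodgeI2002, Thm. 11.30] -/
theorem weilClassesField_biproduct_le_algebraicClasses_of_mem_adjoin_definiteQuaternion_diagonal_of_dvd
    (hA : 0 < A.dim) (hh : h ∈ hodgeClassSpan A.dim A.X 1) (htop : lefschetzPow h (A.dim - 1) 2 h ≠ 0)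
    (hnd : ∀ x : complexBetti A.X 1, (∀ y, polarizationPairingOne A.X h (A.dim - 1) x y = 0) → x = 0)
    (ha : a ≠ 0) (hα2 : pullbackOne A α * pullbackOne A α = a • 1)
    (hb : b ≠ 0) (hβ2 : pullbackOne A β * pullbackOne A β = b • 1)
    (hanti : pullbackOne A α * pullbackOne A β = -(pullbackOne A β * pullbackOne A α))
    (hαskew : ∀ v w : complexBetti A.X 1, polarizationPairingOne A.X h (A.dim - 1) (pullbackOne A α v) w =
      -polarizationPairingOne A.X h (A.dim - 1) v (pullbackOne A α w))
    (hβskew : ∀ v w : complexBetti A.X 1, polarizationPairingOne A.X h (A.dim - 1) (pullbackOne A β v) w =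
      -polarizationPairingOne A.X h (A.dim - 1) v (pullbackOne A β w))
    (hPm : P.Monic) (hPe : P.natDegree = e) (hPirr : Irreducible (P.map (Int.castRingHom ℚ)))
    (hφ : Polynomial.eval₂ (Int.castRingHom (CategoryTheory.End (⨁ (fun _ : Fin (n + 1) => A))))
      (φ : CategoryTheory.End (⨁ (fun _ : Fin (n + 1) => A))) P = 0)
    (her : e * (2 * m) = 2 * ((n + 1) * A.dim))
    (hF : pullbackOne (⨁ (fun _ : Fin (n + 1) => A)) φ ∈ Algebra.adjoin ℂ
      (insert (pullbackOne (⨁ (fun _ : Fin (n + 1) => A)) (biproduct.map fun _ : Fin (n + 1) => α))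
        (insert (pullbackOne (⨁ (fun _ : Fin (n + 1) => A)) (biproduct.map fun _ : Fin (n + 1) => β))
          (Set.range fun ab : Fin (n + 1) × Fin (n + 1) ↦ pullbackOne (⨁ (fun _ : Fin (n + 1) => A))
            (biproduct.π (fun _ : Fin (n + 1) => A) ab.1 ≫ biproduct.ι (fun _ : Fin (n + 1) => A) ab.2)))))
    (hdvd : A.dim ∣ m) :
    weilClassesField (⨁ (fun _ : Fin (n + 1) => A)) φ P (2 * m) ≤ algebraicClasses (⨁ (fun _ : Fin (n + 1) => A)).X m :=
  (weilClassesField_biproduct_le_divisorClassesSpan_of_mem_adjoin_definiteQuaternion_diagonal_of_dvd hA hh htop hnd ha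
      hα2 hb hβ2 hanti hαskew hβskew hPm hPe hPirr hφ her hF hdvd).trans
    (AbelianVariety.divisorClassesSpan_le_algebraicClasses (⨁ (fun _ : Fin (n + 1) => A))
      (fun c hc hc' ↦ lefschetzOneOne_rational_holds
        (AbelianVariety.isSmoothProjective_holds (A := (⨁ (fun _ : Fin (n + 1) => A)))) c hc hc') m)

end DefiniteQuaternionOverRat

end Literature.AlgebraicGeometry.HodgeTheory

end
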